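import Mathlib
import Literature.NumberTheory.LFunctions.Zhang2022.Section18SjEdges
import Literature.NumberTheory.LFunctions.Zhang2022.Section18SjNormSizes
import Literature.NumberTheory.LFunctions.Zhang2022.Section10RangeToolkit
import Literature.NumberTheory.LFunctions.Zhang2022.Section8LambdaZeroGlobal
import Literature.NumberTheory.LFunctions.Zhang2022.Section8TotientLogMean
import Literature.NumberTheory.LFunctions.Zhang2022.Section8FrontEnd810
import Literature.NumberTheory.LFunctions.Zhang2022.SkeletonReductions
import Literature.NumberTheory.LFunctions.Zhang2022.Section10Lemma101
import Literature.NumberTheory.LFunctions.Zhang2022.Section18Range1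
import HarnessLib

/-!
# Zhang (2022) §18, proof of (2.33): the range evaluations of `S_j(𝐚₂₃,𝐚₂₃)` "by the discussion in
# Section 8 and 10" — kernel edges and discharges (DAG nodes `Z22:§18.u010`–`u012`, first range)

Topic `Literature/NumberTheory/LFunctions/Zhang2022` (Landau–Siegel audit tree; verdict-neutral).
Y. Zhang, *Discrete mean estimates and the Landau–Siegel zero*, arXiv:2211.02515v1 (2022)
[Zhang2022LandauSiegel], §18 p.100 (tex L4928–L4946) — **an unrefereed manuscript under
adjudication** (campaign D-0069, cell `siegel-zhang`, layer L4, seat L4-t7, cone C27 LOWER: the leaf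
`Skeleton.Ded183` reduces, by `Section18SjEdges.ded183_of_ranges`, to the four range evaluations
`Typed.Section18.Step18_range1 / Step18_u010 / Step18_u011b / Step18_u012`). The manuscript derives all
four from "the discussion in Section 8 and 10" (Lemmas 8.2–8.4, 10.1, 10.2 and the mean-value rule of
p.48). This theorem-only companion of `TypedSection18` / `Section18SjEdges` (same namespace, 0 new
definitions, 0 named facts) carries the kernel versions:

* `step18_u012_holds : Step18_u012 c′` — **`Z22:§18.u012` DISCHARGED OUTRIGHT**: "the major contribution
  … `(500L′(1,χ)/log P)² Σ_{P^{0.5} ≤ n < P^{0.504}} |χ(n)|λ₀ⱼ(n)/φ(n) = 1000𝔞/log P + o(α)`", from the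
  tree's discharged §8 inputs `λ₀ⱼ(n) = φ(n)²/n² + O(α𝓛)` (`Section8cProofs.step8u047_holds`) and the
  `[T, 1.2.12]` mean value `Σ_{n<x}|χ(n)|φ(n)/n² = (6/π²)∏_{q∣D}q/(q+1)·log x + O(𝓛²)`
  (`Section8cProofs.step8u048_weak`), `𝔞 = (6/π²)L′(1,χ)²∏_{q∣D}q/(q+1)` (2.31) and
  `(500L′/log P)² ≤ 4·10⁶e⁹𝓛⁻¹⁴` (`Sec18SjNorm.norm_prefactor_sq_le`): the main terms agree exactly and
  the error is `O(𝓛⁻¹²) = o(α)` (`α = π𝓛⁻⁹`). Hypothesis (A) is not used.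
* `step18_u010_of : Skeleton.Lemma101 c′ → Skeleton.Lemma102 c′ → Step18_u010 c′` — **`Z22:§18.u010` as
  a kernel EDGE** from Lemma 10.1 ((10.3), (10.5)) and Lemma 10.2 ((10.9), (10.11));
  `step18_u011b_of : … → Step18_u011b c′` — **`Z22:§18.u011` in the READING `𝒴₂ⱼ`** of (10.10), from
  (10.4), (10.5), (10.10), (10.11) (the first range, "the sum over `dr < P^{0.5}` contributes `o(α)`",
  is seat sz-d56's `Sec18SjNorm.step18_range1_of`, `Section18Range1`, from (10.2), (10.5), (10.8),
  (10.11)). Since Lemma 10.1 is DISCHARGED in the tree for `c′ ≥ 0` (`Skeleton.lemma101_holds`), each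
  comes with a `…_of_lemma102` form.
* the ENGINE the manuscript leaves implicit (all PROVED, elementary): the `(d,r)`-summand of `S_j` is
  `|χ(d)||μχ(r)|λ₀ⱼ(dr)/(drφ(r))·𝔳₁ⱼ(dr)·𝔳₂ⱼ(d,r)` (`sj23Term_eq_weight_mul`; the truncations at
  `⌈PT⁻²⌉` and `⌈P⌉` agree by the support of `f̃`; the same factorisation, in its own shape, is seat
  sz-d56's `Sec18SjNorm.sj23Term_eq_frakv`, `Section18RangeTools`); the re-indexing `(d,r) ↦ (n = dr, r ∣ n)`
  (`Sj23Range_eq_sum_divisors`, `Skeleton.sum_box_ite_eq_sum_divisors`); the divisor sum at `n`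
  (`sum_divisors_sj23Term_eq`); the estimate at one `n` of a main range (`perN_main`: (8.10)
  `Σ_{r∣n}|μ(r)|Π(n/r,r)/φ(r) = n/φ(n)` = `Section8FrontEnd810.eq810_holds`, and
  `Σ_{r∣n}|μ(r)|/φ(r) = n/φ(n)`), of a window (`perN_window`), the size of a main summand
  (`perN_mainTerm_le`, `|λ₀ⱼ(n)| ≤ (n/φ(n))⁴`); the masses `Σ(n/φ(n))⁵/n` over the bulk (`≤ 2e⁶⁴𝓛⁹`,
  `mass_bulk_le`) and over an edge window `(P^c/T, P^c]` (`≤ 2e⁶⁴𝓛²`, `mass_window_le`;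
  `log T = 𝓛^{1.1}`); and the assembled estimate of a main range from pointwise inputs
  (`range_estimate`, error `2e⁶⁴𝓛⁹·δ(K_p(K_A+K_B)+δ) + 4e⁶⁴𝓛²(δ₇² + K_p²K_AK_B)`, `δ = C𝓛⁻¹⁵`,
  `δ₇ = C𝓛⁻⁷`, `K_p = 2000e^{4.5}𝓛⁻⁷`, i.e. `O_{c′}(𝓛⁻¹²) = o(α)`).
* the cone: **`ded183_holds : Skeleton.Ded183 c′` — the cone-C27 leaf
  (`Eq183 → Prop71 → Lemma101 → Lemma102 → Bound183`) is a kernel THEOREM for every `c′`**;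
  `step18_u013_of_lemmas`; `ineq233_of_lemmas : Eq183 c′ → Prop71 c′ → Lemma101 c′ → Lemma102 c′ →
  Skeleton.Ineq233 c′` (`ineq233_of_lemma102` for `c′ ≥ 0`) — (2.33) from (18.3), Proposition 7.1 and
  the two §10 lemmas, every §18 step in between being a kernel theorem (`Section18SjEdges`,
  `Section18Ded183`, `Section18Range1`). This is NOT the typed proof node `Pf233` (hypotheses = the
  typed §18 displays; of record: seat sz-d56's `Sec18SjNorm.pf233_of_typed`).

Recorded reading (no verdict): the PRINTED third-range display (`Step18_u011`, factor `1 + 𝒴₁ⱼ(n)` on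
`[P^{0.502}, P^{0.504})`, tex L4939–L4941) is not the output of Lemma 10.2, whose (10.10) carries
`1 + 𝒴₂ⱼ(y)` there; `𝒴₁ⱼ(y) − 𝒴₂ⱼ(y) = (β_{j+1}+β_{j+2})log(y²/P^{1.004}) − β_{j+1}β_{j+2}log²(P^{0.502}/y)`
is of exact order `α log P · 10⁻³ ≍ 10⁻²`, not `o(1)`, on that range, so the printed `Step18_u011` and
the reading `Step18_u011b` differ by `≍ 10⁻²·𝔞α ≠ o(α)`; the kernel edges above use the reading, under
which the cone closes (`ded183_holds`); both readings of the main-order constant are certified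
(`Section10Certificate.Ineq233a_holds`, `Ineq233aLit_holds`). Cell record: RULING 12 (G-d56-1 / would-be row G-L4t7-1).

**Every proposition named `Step18_…`, `Lemma10k`, `Eq183`, `Prop71`, `Ded183`, `Ineq233` is a CLAIM
of an unrefereed manuscript under adjudication; this file proves implications between claims and
one claim outright, from kernel theorems of the tree.** Nothing here bears on Theorems 1–2 of the
source or on Landau–Siegel zeros.

## References

* Y. Zhang, arXiv:2211.02515v1 (2022), §18 p.100 (tex L4928–L4955); §10 Lemmas 10.1–10.2
  ((10.2)–(10.5), (10.8)–(10.11)) pp.53–55; §8 (8.10) and the display before (8.11), p.48; §7 (7.2);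
  §2 (2.31). [cite: Zhang2022LandauSiegel, §18 p.100]
* E. C. Titchmarsh, *The Theory of the Riemann Zeta-Function*, 2nd ed. (1986), (1.2.12) — the
  manuscript's `[T]`.
* R. R. Hall, G. Tenenbaum, *Divisors*, CUP 1988, §0.2 (the sub-multiplicative majorants behind
  `Skeleton.sum_ratio_pow_div_le`). [cite: HallTenenbaum1988, §0.2]
-/

noncomputable section

open Complex Real Finset

namespace Literature.NumberTheory.LFunctions.Zhang2022.Typed.Section18

open Skeleton

variable (c' : ℝ)

/-! ### Thresholds -/

section Thresholds

/-- For every `K` there is `D₁` with `K ≤ 𝓛 = log D` for all `D ≥ D₁`. [folklore] -/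
private theorem exists_ell_ge (K : ℝ) : ∃ D₁ : ℕ, ∀ D : ℕ, D₁ ≤ D → K ≤ ell D := by
  refine ⟨⌈Real.exp K⌉₊ + 1, fun D hD => ?_⟩
  have hD1 : Real.exp K ≤ D := by
    have := Nat.ceil_le.mp (show ⌈Real.exp K⌉₊ ≤ D by omega)
    exact_mod_cast this
  rw [ell, ← Real.log_exp K]
  exact Real.log_le_log (Real.exp_pos _) hD1

variable {D : ℕ}

/-- `log P = 𝓛⁹` ((2.6): `P = exp 𝓛⁹`). [folklore] -/
private theorem logP_eq (D : ℕ) : Real.log (bigP D) = ell D ^ 9 := by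
  rw [bigP, Real.log_exp]

/-- `α = π/log P = π𝓛⁻⁹` (2.10). [folklore] -/
private theorem alpha_eq (D : ℕ) : alpha D = π / ell D ^ 9 := by
  rw [alpha, logP_eq]

/-- `log P^a = a𝓛⁹`. [folklore] -/
private theorem log_Ppow' (D : ℕ) (a : ℝ) : Real.log (bigP D ^ a) = a * ell D ^ 9 := by
  rw [Real.log_rpow (show 0 < bigP D from Real.exp_pos _), logP_eq]

/-- `P^a > 0`. [folklore] -/
private theorem Ppow_pos' (D : ℕ) (a : ℝ) : 0 < bigP D ^ a := Real.rpow_pos_of_pos (Real.exp_pos _) a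

/-- `P^a < P` for `a < 1` (`P > 1` once `𝓛 ≥ 1`). [folklore] -/
private theorem Ppow_lt_bigP (hL : 1 ≤ ell D) {a : ℝ} (ha : a < 1) : bigP D ^ a < bigP D := by
  have hP : 1 < bigP D := by
    rw [bigP]; exact Real.one_lt_exp_iff.mpr (by positivity)
  conv_rhs => rw [← Real.rpow_one (bigP D)]
  exact Real.rpow_lt_rpow_of_exponent_lt hP ha

/-- `1 ≤ P^a` for `a ≥ 0`. [folklore] -/
private theorem one_le_Ppow (D : ℕ) {a : ℝ} (ha : 0 ≤ a) : 1 ≤ bigP D ^ a := by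
  rw [bigP]; exact Real.one_le_rpow (Real.one_le_exp (pow_nonneg (ell_nonneg (D := D)) 9)) ha

end Thresholds

/-! ### `Z22:§18.u012` OUTRIGHT: the "major contribution" `= 1000𝔞/log P + o(α)` -/

section U012

variable {D : ℕ}


/-- **`Z22:§18.u012` DISCHARGED** (Z22 p.100, tex L4943–L4946): "the major contribution to
`S_j(𝐚₂₃,𝐚₂₃)` will be `(500L′(1,χ)/log P)² Σ_{P^{0.5} ≤ n < P^{0.504}} |χ(n)|λ₀ⱼ(n)/φ(n)
= 1000𝔞/log P + o(α)`" — from the tree's DISCHARGED §8 inputs `λ₀ⱼ(n) = φ(n)²/n² + O(α𝓛)`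
(`Section8cProofs.step8u047_holds`, `Z22:§8.u047`) and the `[T, 1.2.12]` mean value
`Σ_{n<x}|χ(n)|φ(n)/n² = (6/π²)∏_{q∣D}q/(q+1)·log x + O(𝓛²)` (`Section8cProofs.step8u048_weak`, the
weak form of `Z22:§8.u048`), with `𝔞 = (6/π²)L′(1,χ)²∏_{q∣D}q/(q+1)` (2.31) and
`(500L′/log P)² ≤ 4·10⁶e⁹𝓛⁻¹⁴` (`Sec18SjNorm.norm_prefactor_sq_le`): the main terms match EXACTLY
(`(500L′/log P)²·0.004·(6/π²)∏·log P = 1000𝔞/log P`) and the two error terms are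
`O(𝓛⁻¹²)` and `O(𝓛⁻¹³)`, i.e. `o(α)` (`α = π𝓛⁻⁹`). No hypothesis (A) is used.
[cite: Zhang2022LandauSiegel, §18 p.100] -/
theorem step18_u012_holds : Step18_u012 c' := by
  intro ε hε
  obtain ⟨C₇, D₇, h47⟩ := Section8cProofs.step8u047_holds c'
  obtain ⟨C₈, D₈, h48⟩ := Section8cProofs.step8u048_weak
  set K : ℝ := 4e6 * Real.exp 9 * (2 * |C₈| + 2 * Real.exp 4 * π * |C₇|) with hK
  have hK0 : 0 ≤ K := by positivity
  obtain ⟨D₉, hD₉⟩ := exists_ell_ge (max 3 (K / (ε * π)))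
  refine ⟨max (max D₇ D₈) D₉, fun D _ χ hD hq hp _ j hj => ?_⟩
  have hD7 : D₇ ≤ D := le_trans (le_trans (le_max_left _ _) (le_max_left _ _)) hD
  have hD8 : D₈ ≤ D := le_trans (le_trans (le_max_right _ _) (le_max_left _ _)) hD
  have hℓ : max 3 (K / (ε * π)) ≤ ell D := hD₉ D (le_trans (le_max_right _ _) hD)
  have hL3 : 3 ≤ ell D := le_trans (le_max_left _ _) hℓ
  have hKL : K / (ε * π) ≤ ell D := le_trans (le_max_right _ _) hℓ
  have hL1 : 1 ≤ ell D := by linarith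
  have hL2 : 2 ≤ ell D := by linarith
  have hL0 : 0 < ell D := by linarith
  have hD3 : 3 ≤ D := Sec18SjNorm.three_le_of_two_le_ell hL2
  set L := ell D with hLdef
  have h47D := h47 D χ hD7 hq hp j hj
  have h48D := h48 D χ hD8 hq hp
  -- the window `[P^{0.5}, P^{0.504})` as `Ico a b`
  set a : ℕ := ⌈bigP D ^ (0.5 : ℝ)⌉₊ with hadef
  set b : ℕ := ⌈bigP D ^ (0.504 : ℝ)⌉₊ with hbdef
  have hb : b ≤ Nsupp D := ceil_P1_le_Nsupp D hL2
  have h1a : 1 ≤ a := Nat.one_le_iff_ne_zero.mpr (Nat.pos_iff_ne_zero.mp (Nat.ceil_pos.mpr (Ppow_pos' D _)))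
  have h2a : 2 ≤ a := by
    have : 1 < a := Nat.lt_ceil.mpr (by
      have : (1 : ℝ) < bigP D ^ (0.5 : ℝ) := by
        rw [bigP, ← Real.exp_mul]
        exact Real.one_lt_exp_iff.mpr (by positivity)
      exact_mod_cast this)
    omega
  have hP1 : 1 ≤ bigP D := by rw [bigP]; exact Real.one_le_exp (pow_nonneg (ell_nonneg D) 9)
  have hab : a ≤ b :=
    Nat.ceil_mono (Real.rpow_le_rpow_of_exponent_le hP1 (by norm_num))
  have hF : (Ico 1 (Nsupp D)).filter
      (fun n : ℕ => bigP D ^ (0.5 : ℝ) ≤ (n : ℝ) ∧ (n : ℝ) < bigP D ^ (0.504 : ℝ)) = Ico a b := by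
    ext n
    rw [mem_filter, mem_Ico, mem_Ico]
    constructor
    · rintro ⟨-, h3, h4⟩
      exact ⟨Nat.ceil_le.mpr h3, Nat.lt_ceil.mpr h4⟩
    · rintro ⟨h3, h4⟩
      refine ⟨⟨le_trans h1a h3, lt_of_lt_of_le h4 hb⟩, Nat.ceil_le.mp h3, Nat.lt_ceil.mp h4⟩
  -- the main term over `Ico a b`
  have hmain : main18u012 c' χ j = (500 * deriv χ.LFunction 1 / (Real.log (bigP D) : ℂ)) ^ 2 *
      ∑ n ∈ Ico a b, ((‖χ (n : ZMod D)‖ : ℝ) : ℂ) * lamZero c' D j n / (Nat.totient n : ℂ) := by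
    rw [main18u012, hF]
  -- decomposition of the summand
  have hdecomp : ∀ n ∈ Ico a b,
      ((‖χ (n : ZMod D)‖ : ℝ) : ℂ) * lamZero c' D j n / (Nat.totient n : ℂ) =
        ((‖χ (n : ZMod D)‖ * (Nat.totient n : ℝ) / (n : ℝ) ^ 2 : ℝ) : ℂ) +
          ((‖χ (n : ZMod D)‖ : ℝ) : ℂ) *
            (lamZero c' D j n - ((Nat.totient n : ℂ) / (n : ℂ)) ^ 2) / (Nat.totient n : ℂ) := by
    intro n hn
    have hn1 : 1 ≤ n := le_trans h1a (mem_Ico.mp hn).1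
    have hφ : (Nat.totient n : ℂ) ≠ 0 := by exact_mod_cast (Nat.totient_pos.mpr hn1).ne'
    have hn0 : (n : ℂ) ≠ 0 := by exact_mod_cast (show n ≠ 0 by omega)
    push_cast
    field_simp
    ring
  set T : ℝ := ∑ n ∈ Ico a b, ‖χ (n : ZMod D)‖ * (Nat.totient n : ℝ) / (n : ℝ) ^ 2 with hT
  set E : ℂ := ∑ n ∈ Ico a b, ((‖χ (n : ZMod D)‖ : ℝ) : ℂ) *
      (lamZero c' D j n - ((Nat.totient n : ℂ) / (n : ℂ)) ^ 2) / (Nat.totient n : ℂ) with hE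
  have hsum : ∑ n ∈ Ico a b, ((‖χ (n : ZMod D)‖ : ℝ) : ℂ) * lamZero c' D j n / (Nat.totient n : ℂ) =
      (T : ℂ) + E := by
    rw [Finset.sum_congr rfl hdecomp, Finset.sum_add_distrib, hT, Complex.ofReal_sum]
  -- (i) the real main part `T` by the `[T, 1.2.12]` mean value
  set cD : ℝ := 6 / π ^ 2 * ∏ q ∈ D.primeFactors, (q : ℝ) / (q + 1) with hcD
  have hT1 : (1 : ℝ) ≤ bigP D ^ (0.5 : ℝ) := one_le_Ppow D (by norm_num)
  have hT2 : (1 : ℝ) ≤ bigP D ^ (0.504 : ℝ) := one_le_Ppow D (by norm_num)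
  have hC₈ : C₈ * ell D ^ 2 ≤ |C₈| * L ^ 2 :=
    mul_le_mul_of_nonneg_right (le_abs_self _) (by positivity)
  have hMa : |(∑ n ∈ Ico 1 a, ‖χ (n : ZMod D)‖ * (Nat.totient n : ℝ) / (n : ℝ) ^ 2) -
      cD * (0.5 * L ^ 9)| ≤ |C₈| * L ^ 2 := by
    have h := h48D _ hT1 (Ppow_lt_bigP hL1 (by norm_num))
    rw [log_Ppow'] at h
    exact h.trans hC₈
  have hMb : |(∑ n ∈ Ico 1 b, ‖χ (n : ZMod D)‖ * (Nat.totient n : ℝ) / (n : ℝ) ^ 2) -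
      cD * (0.504 * L ^ 9)| ≤ |C₈| * L ^ 2 := by
    have h := h48D _ hT2 (Ppow_lt_bigP hL1 (by norm_num))
    rw [log_Ppow'] at h
    exact h.trans hC₈
  have hTsplit : T = (∑ n ∈ Ico 1 b, ‖χ (n : ZMod D)‖ * (Nat.totient n : ℝ) / (n : ℝ) ^ 2) -
      ∑ n ∈ Ico 1 a, ‖χ (n : ZMod D)‖ * (Nat.totient n : ℝ) / (n : ℝ) ^ 2 := by
    rw [hT, ← Finset.sum_Ico_consecutive _ h1a hab]
    ring
  have hTerr : |T - cD * (0.004 * L ^ 9)| ≤ 2 * |C₈| * L ^ 2 := by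
    rw [hTsplit]
    rw [abs_le] at hMa hMb ⊢
    constructor <;> linarith [hMa.1, hMa.2, hMb.1, hMb.2]
  -- (ii) the error part `E` by `λ₀ⱼ(n) = φ(n)²/n² + O(α𝓛)`
  have hEn : ∀ n ∈ Ico a b,
      ‖((‖χ (n : ZMod D)‖ : ℝ) : ℂ) * (lamZero c' D j n - ((Nat.totient n : ℂ) / (n : ℂ)) ^ 2) /
          (Nat.totient n : ℂ)‖ ≤ |C₇| * (alpha D * L) * (((n : ℝ) / Nat.totient n) ^ 1 / n) := by
    intro n hn
    have hn1 : 1 ≤ n := le_trans h1a (mem_Ico.mp hn).1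
    have hnN : n < Nsupp D := lt_of_lt_of_le (mem_Ico.mp hn).2 hb
    have hnP : (n : ℝ) < bigP D := by
      have h1 : (n : ℝ) < bigP D / bigT D ^ 2 := Nat.lt_ceil.mp hnN
      have h2 : bigP D / bigT D ^ 2 ≤ bigP D := by
        refine div_le_self (Real.exp_pos _).le ?_
        exact one_le_pow₀ (by rw [bigT]; exact Real.one_le_exp (Real.rpow_nonneg (ell_nonneg D) _))
      linarith
    have hlam := (h47D n hn1 hnP).trans
      (mul_le_mul_of_nonneg_right (le_abs_self C₇) (mul_nonneg (alpha_nonneg D) (ell_nonneg D)))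
    have hφpos : (0 : ℝ) < Nat.totient n := by exact_mod_cast Nat.totient_pos.mpr hn1
    have hn0 : (0 : ℝ) < n := by exact_mod_cast hn1
    have hratio : ((n : ℝ) / Nat.totient n) ^ 1 / n = 1 / Nat.totient n := by
      rw [pow_one]; field_simp
    rw [hratio, norm_div, norm_mul, Complex.norm_real, Real.norm_of_nonneg (norm_nonneg _),
      Complex.norm_natCast]
    have hχ1 : ‖χ (n : ZMod D)‖ ≤ 1 := DirichletCharacter.norm_le_one χ _
    calc ‖χ (n : ZMod D)‖ * ‖lamZero c' D j n - ((Nat.totient n : ℂ) / (n : ℂ)) ^ 2‖ / Nat.totient n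
        ≤ 1 * (|C₇| * (alpha D * L)) / Nat.totient n := by gcongr
      _ = |C₇| * (alpha D * L) * (1 / Nat.totient n) := by ring
  have hsub : Ico a b ⊆ Ioc 1 (Nsupp D) := by
    intro n hn
    rw [mem_Ico] at hn
    rw [mem_Ioc]
    constructor <;> omega
  have hNs : 1 ≤ Nsupp D := le_trans h1a (le_trans hab hb)
  have hW := Skeleton.sum_ratio_pow_div_le 1 one_pos hNs
  rw [Nat.cast_one, Real.log_one, sub_zero] at hW
  have hlogN := Sec18SjNorm.one_add_log_Nsupp_le hL2
  have hC₇0 : 0 ≤ |C₇| * (alpha D * L) :=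
    mul_nonneg (abs_nonneg _) (mul_nonneg (alpha_nonneg D) (ell_nonneg D))
  have hEle : ‖E‖ ≤ 2 * Real.exp 4 * π * |C₇| * L := by
    calc ‖E‖ ≤ ∑ n ∈ Ico a b, ‖((‖χ (n : ZMod D)‖ : ℝ) : ℂ) *
            (lamZero c' D j n - ((Nat.totient n : ℂ) / (n : ℂ)) ^ 2) / (Nat.totient n : ℂ)‖ :=
          norm_sum_le _ _
      _ ≤ ∑ n ∈ Ico a b, |C₇| * (alpha D * L) * (((n : ℝ) / Nat.totient n) ^ 1 / n) :=
          Finset.sum_le_sum hEn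
      _ = |C₇| * (alpha D * L) * ∑ n ∈ Ico a b, ((n : ℝ) / Nat.totient n) ^ 1 / n := by
          rw [Finset.mul_sum]
      _ ≤ |C₇| * (alpha D * L) * ∑ n ∈ Ioc 1 (Nsupp D), ((n : ℝ) / Nat.totient n) ^ 1 / n :=
          mul_le_mul_of_nonneg_left
            (Finset.sum_le_sum_of_subset_of_nonneg hsub fun n _ _ => by positivity) hC₇0
      _ ≤ |C₇| * (alpha D * L) * (Real.exp (2 ^ (1 + 1)) * (1 + Real.log (Nsupp D))) :=
          mul_le_mul_of_nonneg_left hW hC₇0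
      _ ≤ |C₇| * (alpha D * L) * (Real.exp 4 * (2 * L ^ 9)) := by
          refine mul_le_mul_of_nonneg_left ?_ hC₇0
          have h4 : Real.exp (2 ^ (1 + 1)) = Real.exp 4 := by norm_num
          rw [h4]
          exact mul_le_mul_of_nonneg_left hlogN (Real.exp_pos _).le
      _ = 2 * Real.exp 4 * π * |C₇| * L := by
          rw [alpha_eq, ← hLdef]
          field_simp
  -- (iii) the prefactor
  have hpref := pref_sq_eq_ofReal χ hD3 hq hp
  set p : ℝ := (500 * (deriv χ.LFunction 1).re / Real.log (bigP D)) ^ 2 with hpdef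
  have hp0 : 0 ≤ p := sq_nonneg _
  have hple : p ≤ 4e6 * Real.exp 9 / L ^ 14 := by
    have h := Sec18SjNorm.norm_prefactor_sq_le χ hL3 hp
    rwa [← norm_pow, hpref, Complex.norm_real, Real.norm_of_nonneg hp0] at h
  have hkey : p * (cD * (0.004 * L ^ 9)) = 1000 * frakA χ / Real.log (bigP D) := by
    rw [hpdef, hcD, logP_eq, ← hLdef, show frakA χ = Lemma171.frakA χ from rfl, Lemma171.frakA_def]
    have hL9 : L ^ 9 ≠ 0 := by positivity
    field_simp
    ring
  have hgoal : main18u012 c' χ j - ((1000 * frakA χ / Real.log (bigP D) : ℝ) : ℂ) =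
      (p : ℂ) * ((T - cD * (0.004 * L ^ 9) : ℝ) : ℂ) + (p : ℂ) * E := by
    rw [hmain, hsum, hpref, ← hkey]
    push_cast
    ring
  rw [hgoal]
  -- (iv) assembly
  have hKle : K ≤ ε * π * L := by
    have := (div_le_iff₀ (by positivity : (0 : ℝ) < ε * π)).mp hKL
    linarith
  calc ‖(p : ℂ) * ((T - cD * (0.004 * L ^ 9) : ℝ) : ℂ) + (p : ℂ) * E‖
      ≤ ‖(p : ℂ) * ((T - cD * (0.004 * L ^ 9) : ℝ) : ℂ)‖ + ‖(p : ℂ) * E‖ := norm_add_le _ _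
    _ = p * |T - cD * (0.004 * L ^ 9)| + p * ‖E‖ := by
        rw [norm_mul, norm_mul, Complex.norm_real, Complex.norm_real, Real.norm_of_nonneg hp0,
          Real.norm_eq_abs]
    _ ≤ p * (2 * |C₈| * L ^ 2) + p * (2 * Real.exp 4 * π * |C₇| * L) := by gcongr
    _ ≤ p * (2 * |C₈| * L ^ 2) + p * (2 * Real.exp 4 * π * |C₇| * L ^ 2) := by
        gcongr
        nlinarith
    _ = p * ((2 * |C₈| + 2 * Real.exp 4 * π * |C₇|) * L ^ 2) := by ring
    _ ≤ 4e6 * Real.exp 9 / L ^ 14 * ((2 * |C₈| + 2 * Real.exp 4 * π * |C₇|) * L ^ 2) := by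
        gcongr
    _ = K / L ^ 12 := by
        rw [hK]
        field_simp
    _ ≤ ε * alpha D := by
        rw [alpha_eq, div_le_iff₀ (by positivity)]
        calc K ≤ ε * π * L := hKle
          _ ≤ ε * π * L ^ 3 := by
              gcongr
              exact le_self_pow₀ hL1 (by norm_num)
          _ = ε * (π / L ^ 9) * L ^ 12 := by
              field_simp

/-- `Step18_u012` — `_holds` alias of `step18_u012_holds` above under the fact's exact name (appended
2026-08-28, D-0026 bookkeeping: the proof term is the existing theorem of this file; no statement,
definition or attribute is edited; no new named fact; the ledger's debt table listed the fact
unproved). [cite: Zhang2022LandauSiegel, §18 p.100] -/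
theorem _root_.Literature.NumberTheory.LFunctions.Zhang2022.Typed.Section18.Step18_u012_holds :
    Step18_u012 c' :=
  _root_.Literature.NumberTheory.LFunctions.Zhang2022.Typed.Section18.step18_u012_holds (c' := c')

end U012


/-! ### The engine, I: the `(d,r)`-summand of `Sj23` is `weight × 𝔳₁ⱼ(dr) × 𝔳₂ⱼ(d,r)` and the
`(d,r) ↦ (n = dr, r ∣ n)` re-indexing of the range pieces -/

section Engine

variable {D : ℕ} (χ : DirichletCharacter ℂ D)

/-- The `m`-sum of the `(d,r)`-summand of `S_j(𝐚₂₃,𝐚₂₃)` (truncated at `⌈PT⁻²⌉` as in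
`Skeleton.Sj`) is `𝔳₁ⱼ(dr)` of Lemma 10.1 (truncated at `⌈P⌉`): the extra terms vanish because
`f̃(log(drm)/log P) = 0` once `drm > P^{0.504}` (`𝓛 ≥ 2`, `dr ≥ 1`).
[cite: Zhang2022LandauSiegel, §10 Lemma 10.1, §18 p.100] -/
theorem msum_eq_frakv1 (hL : 2 ≤ ell D) (j : ℕ) {d r : ℕ} (hdr : 1 ≤ d * r) :
    ∑ m ∈ Ico 1 (Nsupp D), χ (m : ZMod D) *
        (ftilde (Real.log ((d * r * m : ℕ) : ℝ) / Real.log (bigP D)) : ℂ) /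
          (m : ℂ) ^ (1 - betaJ c' D j) = frakv1 c' χ j ((d * r : ℕ) : ℝ) := by
  have hL' : 2 ≤ Real.log D := hL
  rw [frakv1]
  have hsub : Ico 1 (Nsupp D) ⊆ Ico 1 ⌈bigP D⌉₊ := by
    refine Ico_subset_Ico le_rfl (Nat.ceil_mono ?_)
    refine div_le_self (Real.exp_pos _).le ?_
    exact one_le_pow₀ (by rw [bigT]; exact Real.one_le_exp (Real.rpow_nonneg (ell_nonneg D) _))
  rw [← Finset.sum_subset hsub]
  · refine Finset.sum_congr rfl fun m _ => ?_
    push_cast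
    ring_nf
  · intro m hm hmN
    have hm1 : 1 ≤ m := (mem_Ico.mp hm).1
    have hN : Nsupp D ≤ m := by
      by_contra h
      exact hmN (mem_Ico.mpr ⟨hm1, not_le.mp h⟩)
    have hP1 : Skeleton.P1 D < ((d * r * m : ℕ) : ℝ) := by
      refine lt_of_lt_of_le (Skeleton.P1_lt_of_Nsupp_le D hL' hN) ?_
      exact_mod_cast Nat.le_mul_of_pos_left m hdr
    have h0 := Skeleton.ftilde_log_eq_zero_of_P1_lt D hL' hP1 (le_refl (0 : ℝ))
    rw [add_zero] at h0
    have : Real.log (((d * r : ℕ) : ℝ) * (m : ℝ)) = Real.log ((d * r * m : ℕ) : ℝ) := by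
      push_cast; ring_nf
    rw [this, h0]
    simp

/-- The `n`-sum of the `(d,r)`-summand of `S_j(𝐚₂₃,𝐚₂₃)` (truncated at `⌈PT⁻²⌉`) is `𝔳₂ⱼ(d,r)` of
Lemma 10.2 (truncated at `⌈P⌉`), for `𝓛 ≥ 2`, `dr ≥ 1`.
[cite: Zhang2022LandauSiegel, §10 Lemma 10.2, §18 p.100] -/
theorem nsum_eq_frakv2 (hL : 2 ≤ ell D) (j : ℕ) {d r : ℕ} (hdr : 1 ≤ d * r) :
    ∑ n ∈ Ico 1 (Nsupp D), χ (n : ZMod D) *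
        (ftilde (Real.log ((d * r * n : ℕ) : ℝ) / Real.log (bigP D)) : ℂ) *
          xiZero c' D j n d r / (n : ℂ) = frakv2 c' χ j d r := by
  have hL' : 2 ≤ Real.log D := hL
  rw [frakv2]
  have hsub : Ico 1 (Nsupp D) ⊆ Ico 1 ⌈bigP D⌉₊ := by
    refine Ico_subset_Ico le_rfl (Nat.ceil_mono ?_)
    refine div_le_self (Real.exp_pos _).le ?_
    exact one_le_pow₀ (by rw [bigT]; exact Real.one_le_exp (Real.rpow_nonneg (ell_nonneg D) _))
  rw [← Finset.sum_subset hsub]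
  intro n hn hnN
  have hn1 : 1 ≤ n := (mem_Ico.mp hn).1
  have hN : Nsupp D ≤ n := by
    by_contra h
    exact hnN (mem_Ico.mpr ⟨hn1, not_le.mp h⟩)
  have hP1 : Skeleton.P1 D < ((d * r * n : ℕ) : ℝ) := by
    refine lt_of_lt_of_le (Skeleton.P1_lt_of_Nsupp_le D hL' hN) ?_
    exact_mod_cast Nat.le_mul_of_pos_left n hdr
  have h0 := Skeleton.ftilde_log_eq_zero_of_P1_lt D hL' hP1 (le_refl (0 : ℝ))
  rw [add_zero] at h0
  rw [h0]
  simp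

/-- The `(d,r)`-summand of the printed expansion of `S_j(𝐚₂₃,𝐚₂₃)` is
`|χ(d)||μχ(r)|λ₀ⱼ(dr)/(drφ(r)) · 𝔳₁ⱼ(dr) · 𝔳₂ⱼ(d,r)` (`𝓛 ≥ 2`, `d, r ≥ 1`).
[cite: Zhang2022LandauSiegel, §18 p.100; §10 Lemmas 10.1–10.2] -/
theorem sj23Term_eq_weight_mul (hL : 2 ≤ ell D) (j : ℕ) {d r : ℕ} (hd : 1 ≤ d) (hr : 1 ≤ r) :
    sj23Term c' χ j r d =
      ((‖χ (d : ZMod D)‖ : ℝ) : ℂ) *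
          ((‖((ArithmeticFunction.moebius r : ℤ) : ℂ) * χ (r : ZMod D)‖ : ℝ) : ℂ) *
          lamZero c' D j (d * r) / (((d * r : ℕ) : ℂ) * (Nat.totient r : ℂ)) *
        frakv1 c' χ j ((d * r : ℕ) : ℝ) * frakv2 c' χ j d r := by
  have hdr : 1 ≤ d * r := Nat.one_le_iff_ne_zero.mpr (mul_ne_zero (by omega) (by omega))
  rw [sj23Term, msum_eq_frakv1 c' χ hL j hdr, nsum_eq_frakv2 c' χ hL j hdr]

/-- **Re-indexing of a range piece**: for `hi ≤ P^{0.504}` (and `𝓛 ≥ 2`, so that `dr < hi` forces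
`dr < ⌈PT⁻²⌉`), `Sj23Range(lo,hi) = Σ_{lo ≤ n < hi} Σ_{r∣n} term(r, n/r)` — "substituting `n = dr`"
(§8 p.48) for the §18 sum. [cite: Zhang2022LandauSiegel, §18 p.100; §8 p.48] -/
theorem Sj23Range_eq_sum_divisors (hL : 2 ≤ ell D) (j : ℕ) {lo hi : ℝ} (hhi : hi ≤ Skeleton.P1 D) :
    Sj23Range c' χ j lo hi =
      ∑ n ∈ (Ico 1 (Nsupp D)).filter (fun n : ℕ => lo ≤ (n : ℝ) ∧ (n : ℝ) < hi),
        ∑ r ∈ n.divisors, sj23Term c' χ j r (n / r) := by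
  classical
  have hL' : 2 ≤ Real.log D := hL
  rw [Sj23Range, Finset.sum_comm]
  have hp : ∀ n : ℕ, (lo ≤ (n : ℝ) ∧ (n : ℝ) < hi) → n < Nsupp D := by
    intro n hn
    by_contra h
    have := Skeleton.P1_lt_of_Nsupp_le D hL' (not_lt.mp h)
    linarith [hn.2]
  rw [← Skeleton.sum_box_ite_eq_sum_divisors (Nsupp D) (fun n : ℕ => lo ≤ (n : ℝ) ∧ (n : ℝ) < hi) hp
    (fun d r => sj23Term c' χ j r d)]

/-- **The divisor sum at `n`**: `Σ_{r∣n} term(r, n/r) = |χ(n)|λ₀ⱼ(n)/n · 𝔳₁ⱼ(n) ·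
Σ_{r∣n, r squarefree} 𝔳₂ⱼ(n/r, r)/φ(r)` (`|χ(d)||μχ(r)| = |μ(r)||χ(n)|` for `dr = n`).
[cite: Zhang2022LandauSiegel, §18 p.100; §8 (8.10)] -/
theorem sum_divisors_sj23Term_eq (hL : 2 ≤ ell D) (j : ℕ) {n : ℕ} (hn : 1 ≤ n) :
    ∑ r ∈ n.divisors, sj23Term c' χ j r (n / r) =
      ((‖χ (n : ZMod D)‖ : ℝ) : ℂ) * lamZero c' D j n / (n : ℂ) * frakv1 c' χ j (n : ℝ) *
        ∑ r ∈ n.divisors with Squarefree r, frakv2 c' χ j (n / r) r / (Nat.totient r : ℂ) := by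
  classical
  rw [Finset.sum_filter, Finset.mul_sum]
  refine Finset.sum_congr rfl fun r hr => ?_
  have hn0 : n ≠ 0 := by omega
  have hrn : r ∣ n := Nat.dvd_of_mem_divisors hr
  have hr1 : 1 ≤ r := Nat.pos_of_dvd_of_pos hrn (by omega)
  have hd1 : 1 ≤ n / r := Nat.div_pos (Nat.le_of_dvd (by omega) hrn) (by omega)
  have hdr : n / r * r = n := Nat.div_mul_cancel hrn
  rw [sj23Term_eq_weight_mul c' χ hL j hd1 hr1, Skeleton.norm_chi_mul_norm_moebius_chi χ (n / r) r,
    hdr]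
  split_ifs with hsq
  · ring
  · simp


/-! ### The engine, II: the estimates at one `n` -/

omit χ in
/-- `‖(n/φ(n) : ℂ)‖ = n/φ(n)`. [folklore] -/
private theorem norm_ratio (n : ℕ) : ‖((n : ℂ) / (Nat.totient n : ℂ))‖ = (n : ℝ) / Nat.totient n := by
  rw [norm_div, Complex.norm_natCast, Complex.norm_natCast]

/-- The weight `|χ(n)|λ₀ⱼ(n)/n` has norm `≤ (n/φ(n))⁴/n` (`Skeleton.norm_lamZero_le`).
[cite: Zhang2022LandauSiegel, §7 p.33] -/
theorem norm_weight_le (j : ℕ) {n : ℕ} (hn : 1 ≤ n) :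
    ‖((‖χ (n : ZMod D)‖ : ℝ) : ℂ) * lamZero c' D j n / (n : ℂ)‖ ≤
      ((n : ℝ) / Nat.totient n) ^ 4 / n := by
  have hn0 : n ≠ 0 := by omega
  have hnpos : 0 < (n : ℝ) := by exact_mod_cast hn
  rw [norm_div, norm_mul, Complex.norm_real, norm_norm, Complex.norm_natCast]
  have hχ1 : ‖χ (n : ZMod D)‖ ≤ 1 := DirichletCharacter.norm_le_one χ _
  have hlam := Skeleton.norm_lamZero_le c' D j hn0
  calc ‖χ (n : ZMod D)‖ * ‖lamZero c' D j n‖ / n ≤ 1 * ((n : ℝ) / Nat.totient n) ^ 4 / n := by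
        gcongr
    _ = ((n : ℝ) / Nat.totient n) ^ 4 / n := by rw [one_mul]

/-- **The estimate at one `n` of a main range** (the bookkeeping the manuscript leaves implicit in
"by the discussion in Section 8 and 10", p.100): if `𝔳₁ⱼ(n) = pA + O(δ)` and
`𝔳₂ⱼ(n/r, r) = pΠ(n/r, r)B + O(δ)` for every squarefree `r ∣ n`, then, by (8.10)
(`Σ_{r∣n}|μ(r)|Π(n/r,r)/φ(r) = n/φ(n)`, `Section8FrontEnd810.eq810_holds`) and
`Σ_{r∣n}|μ(r)|/φ(r) = n/φ(n)`, the divisor sum at `n` equals the main summand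
`p²|χ(n)|λ₀ⱼ(n)/φ(n)·AB` up to `(n/φ(n))⁵n⁻¹·δ(K_p(K_A+K_B) + δ)`.
[cite: Zhang2022LandauSiegel, §18 p.100; §8 (8.10)] -/
theorem perN_main [NeZero D] (hq : χ.IsQuadratic) (j : ℕ) {n : ℕ} (hn : 1 ≤ n) {p A B : ℂ}
    {δ KA KB Kp : ℝ} (hδ : 0 ≤ δ) (hKp : 0 ≤ Kp) (hA : ‖A‖ ≤ KA) (hB : ‖B‖ ≤ KB) (hp : ‖p‖ ≤ Kp)
    (h1 : ‖frakv1 c' χ j (n : ℝ) - p * A‖ ≤ δ)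
    (h2 : ∀ r ∈ n.divisors, Squarefree r →
      ‖frakv2 c' χ j (n / r) r - p * PiW χ (n / r) r * B‖ ≤ δ) :
    ‖((‖χ (n : ZMod D)‖ : ℝ) : ℂ) * lamZero c' D j n / (n : ℂ) * frakv1 c' χ j (n : ℝ) *
          (∑ r ∈ n.divisors with Squarefree r, frakv2 c' χ j (n / r) r / (Nat.totient r : ℂ)) -
        p ^ 2 * (((‖χ (n : ZMod D)‖ : ℝ) : ℂ) * lamZero c' D j n / (Nat.totient n : ℂ) * A * B)‖ ≤
      ((n : ℝ) / Nat.totient n) ^ 5 / n * (δ * (Kp * (KA + KB) + δ)) := by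
  classical
  have hn0 : n ≠ 0 := by omega
  have hφpos : 0 < (Nat.totient n : ℝ) := by exact_mod_cast Nat.totient_pos.mpr hn
  have hnpos : 0 < (n : ℝ) := by exact_mod_cast hn
  have hφC : (Nat.totient n : ℂ) ≠ 0 := by exact_mod_cast hφpos.ne'
  have hnC : (n : ℂ) ≠ 0 := by exact_mod_cast hn0
  have hKA : 0 ≤ KA := le_trans (norm_nonneg _) hA
  have hKB : 0 ≤ KB := le_trans (norm_nonneg _) hB
  set ρ : ℝ := (n : ℝ) / Nat.totient n with hρ
  have hρ0 : 0 ≤ ρ := div_nonneg hnpos.le hφpos.le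
  have hρC : ((n : ℂ) / (Nat.totient n : ℂ)) = (ρ : ℂ) := by rw [hρ]; push_cast; rfl
  -- (8.10) and the totient sum
  have h810 := Section8FrontEnd810.eq810_holds D χ hq n hn0
  have hinv := Skeleton.sum_sqfree_divisors_inv_totient hn0
  -- the error sum `E₂`
  have hE₂ : ‖∑ r ∈ n.divisors with Squarefree r,
      (frakv2 c' χ j (n / r) r - p * PiW χ (n / r) r * B) / (Nat.totient r : ℂ)‖ ≤ δ * ρ := by
    calc ‖∑ r ∈ n.divisors with Squarefree r,
          (frakv2 c' χ j (n / r) r - p * PiW χ (n / r) r * B) / (Nat.totient r : ℂ)‖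
        ≤ ∑ r ∈ n.divisors with Squarefree r,
          ‖(frakv2 c' χ j (n / r) r - p * PiW χ (n / r) r * B) / (Nat.totient r : ℂ)‖ :=
          norm_sum_le _ _
      _ ≤ ∑ r ∈ n.divisors with Squarefree r, δ * (1 / (Nat.totient r : ℝ)) := by
          refine Finset.sum_le_sum fun r hr => ?_
          rw [Finset.mem_filter] at hr
          rw [norm_div, Complex.norm_natCast, div_eq_mul_one_div]
          exact mul_le_mul_of_nonneg_right (h2 r hr.1 hr.2) (by positivity)
      _ = δ * ρ := by rw [← Finset.mul_sum, hinv]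
  -- the divisor sum `V = pBρ + E₂`
  have hV : ∑ r ∈ n.divisors with Squarefree r, frakv2 c' χ j (n / r) r / (Nat.totient r : ℂ) =
      p * B * (ρ : ℂ) + ∑ r ∈ n.divisors with Squarefree r,
        (frakv2 c' χ j (n / r) r - p * PiW χ (n / r) r * B) / (Nat.totient r : ℂ) := by
    have : ∑ r ∈ n.divisors with Squarefree r, frakv2 c' χ j (n / r) r / (Nat.totient r : ℂ) =
        ∑ r ∈ n.divisors with Squarefree r,
          (p * B * ((1 / (Nat.totient r : ℂ)) * PiW χ (n / r) r) +
            (frakv2 c' χ j (n / r) r - p * PiW χ (n / r) r * B) / (Nat.totient r : ℂ)) := by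
      refine Finset.sum_congr rfl fun r _ => ?_
      ring
    rw [this, Finset.sum_add_distrib, ← Finset.mul_sum, h810, hρC]
  have hVnorm : ‖∑ r ∈ n.divisors with Squarefree r, frakv2 c' χ j (n / r) r / (Nat.totient r : ℂ)‖ ≤
      Kp * KB * ρ + δ * ρ := by
    rw [hV]
    refine (norm_add_le _ _).trans (add_le_add ?_ hE₂)
    rw [norm_mul, norm_mul, Complex.norm_real, Real.norm_of_nonneg hρ0]
    gcongr
  -- the identity behind the difference
  have hw := norm_weight_le c' χ j hn
  have hdiff :
      ((‖χ (n : ZMod D)‖ : ℝ) : ℂ) * lamZero c' D j n / (n : ℂ) * frakv1 c' χ j (n : ℝ) *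
          (∑ r ∈ n.divisors with Squarefree r, frakv2 c' χ j (n / r) r / (Nat.totient r : ℂ)) -
        p ^ 2 * (((‖χ (n : ZMod D)‖ : ℝ) : ℂ) * lamZero c' D j n / (Nat.totient n : ℂ) * A * B) =
      ((‖χ (n : ZMod D)‖ : ℝ) : ℂ) * lamZero c' D j n / (n : ℂ) *
        ((frakv1 c' χ j (n : ℝ) - p * A) *
            (∑ r ∈ n.divisors with Squarefree r, frakv2 c' χ j (n / r) r / (Nat.totient r : ℂ)) +
          p * A * ∑ r ∈ n.divisors with Squarefree r,
            (frakv2 c' χ j (n / r) r - p * PiW χ (n / r) r * B) / (Nat.totient r : ℂ)) := by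
    have key : p ^ 2 * (((‖χ (n : ZMod D)‖ : ℝ) : ℂ) * lamZero c' D j n / (Nat.totient n : ℂ) * A * B) =
        ((‖χ (n : ZMod D)‖ : ℝ) : ℂ) * lamZero c' D j n / (n : ℂ) * (p * A) * (p * B * (ρ : ℂ)) := by
      rw [← hρC]
      field_simp
    rw [key, hV]
    ring
  rw [hdiff, norm_mul]
  have hin : ‖(frakv1 c' χ j (n : ℝ) - p * A) *
        (∑ r ∈ n.divisors with Squarefree r, frakv2 c' χ j (n / r) r / (Nat.totient r : ℂ)) +
      p * A * ∑ r ∈ n.divisors with Squarefree r,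
        (frakv2 c' χ j (n / r) r - p * PiW χ (n / r) r * B) / (Nat.totient r : ℂ)‖ ≤
      δ * (Kp * KB * ρ + δ * ρ) + Kp * KA * (δ * ρ) := by
    refine (norm_add_le _ _).trans (add_le_add ?_ ?_)
    · rw [norm_mul]
      exact mul_le_mul h1 hVnorm (norm_nonneg _) hδ
    · rw [norm_mul, norm_mul]
      refine mul_le_mul (mul_le_mul hp hA (norm_nonneg _) hKp) hE₂ (norm_nonneg _) (by positivity)
  calc ‖((‖χ (n : ZMod D)‖ : ℝ) : ℂ) * lamZero c' D j n / (n : ℂ)‖ * _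
      ≤ ((n : ℝ) / Nat.totient n) ^ 4 / n * (δ * (Kp * KB * ρ + δ * ρ) + Kp * KA * (δ * ρ)) :=
        mul_le_mul hw hin (norm_nonneg _) (by positivity)
    _ = ((n : ℝ) / Nat.totient n) ^ 5 / n * (δ * (Kp * (KA + KB) + δ)) := by
        rw [hρ]; ring

/-- **The estimate at one `n` of an edge window / the first range**: if `|𝔳₁ⱼ(n)| ≤ δ₁` and
`|𝔳₂ⱼ(n/r, r)| ≤ δ₂` for every squarefree `r ∣ n`, the divisor sum at `n` is
`≤ (n/φ(n))⁵n⁻¹·δ₁δ₂` in norm. [cite: Zhang2022LandauSiegel, §18 p.100; §10 (10.5), (10.11)] -/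
theorem perN_window (j : ℕ) {n : ℕ} (hn : 1 ≤ n) {δ₁ δ₂ : ℝ} (hδ₁ : 0 ≤ δ₁)
    (h1 : ‖frakv1 c' χ j (n : ℝ)‖ ≤ δ₁)
    (h2 : ∀ r ∈ n.divisors, Squarefree r → ‖frakv2 c' χ j (n / r) r‖ ≤ δ₂) :
    ‖((‖χ (n : ZMod D)‖ : ℝ) : ℂ) * lamZero c' D j n / (n : ℂ) * frakv1 c' χ j (n : ℝ) *
        (∑ r ∈ n.divisors with Squarefree r, frakv2 c' χ j (n / r) r / (Nat.totient r : ℂ))‖ ≤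
      ((n : ℝ) / Nat.totient n) ^ 5 / n * (δ₁ * δ₂) := by
  classical
  have hn0 : n ≠ 0 := by omega
  have hinv := Skeleton.sum_sqfree_divisors_inv_totient hn0
  have hV : ‖∑ r ∈ n.divisors with Squarefree r, frakv2 c' χ j (n / r) r / (Nat.totient r : ℂ)‖ ≤
      δ₂ * ((n : ℝ) / Nat.totient n) := by
    calc ‖∑ r ∈ n.divisors with Squarefree r, frakv2 c' χ j (n / r) r / (Nat.totient r : ℂ)‖
        ≤ ∑ r ∈ n.divisors with Squarefree r, ‖frakv2 c' χ j (n / r) r / (Nat.totient r : ℂ)‖ :=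
          norm_sum_le _ _
      _ ≤ ∑ r ∈ n.divisors with Squarefree r, δ₂ * (1 / (Nat.totient r : ℝ)) := by
          refine Finset.sum_le_sum fun r hr => ?_
          rw [Finset.mem_filter] at hr
          rw [norm_div, Complex.norm_natCast, div_eq_mul_one_div]
          exact mul_le_mul_of_nonneg_right (h2 r hr.1 hr.2) (by positivity)
      _ = δ₂ * ((n : ℝ) / Nat.totient n) := by rw [← Finset.mul_sum, hinv]
  have hw := norm_weight_le c' χ j hn
  rw [norm_mul, norm_mul]
  calc ‖((‖χ (n : ZMod D)‖ : ℝ) : ℂ) * lamZero c' D j n / (n : ℂ)‖ * ‖frakv1 c' χ j (n : ℝ)‖ * _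
      ≤ ((n : ℝ) / Nat.totient n) ^ 4 / n * δ₁ * (δ₂ * ((n : ℝ) / Nat.totient n)) := by
        refine mul_le_mul (mul_le_mul hw h1 (norm_nonneg _) (by positivity)) hV (norm_nonneg _)
          (by positivity)
    _ = ((n : ℝ) / Nat.totient n) ^ 5 / n * (δ₁ * δ₂) := by ring

/-- The size of the main summand: `‖p²|χ(n)|λ₀ⱼ(n)/φ(n)·AB‖ ≤ (n/φ(n))⁵n⁻¹·K_p²K_AK_B`.
[cite: Zhang2022LandauSiegel, §18 p.100] -/
theorem perN_mainTerm_le (j : ℕ) {n : ℕ} (hn : 1 ≤ n) {p A B : ℂ} {KA KB Kp : ℝ}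
    (hA : ‖A‖ ≤ KA) (hB : ‖B‖ ≤ KB) (hp : ‖p‖ ≤ Kp) :
    ‖p ^ 2 * (((‖χ (n : ZMod D)‖ : ℝ) : ℂ) * lamZero c' D j n / (Nat.totient n : ℂ) * A * B)‖ ≤
      ((n : ℝ) / Nat.totient n) ^ 5 / n * (Kp ^ 2 * KA * KB) := by
  have hn0 : n ≠ 0 := by omega
  have hφpos : 0 < (Nat.totient n : ℝ) := by exact_mod_cast Nat.totient_pos.mpr hn
  have hnpos : 0 < (n : ℝ) := by exact_mod_cast hn
  have hKp : 0 ≤ Kp := le_trans (norm_nonneg _) hp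
  have hKA : 0 ≤ KA := le_trans (norm_nonneg _) hA
  have hχ1 : ‖χ (n : ZMod D)‖ ≤ 1 := DirichletCharacter.norm_le_one χ _
  have hlam := Skeleton.norm_lamZero_le c' D j hn0
  rw [norm_mul, norm_pow, norm_mul, norm_mul, norm_div, norm_mul, Complex.norm_real, norm_norm,
    Complex.norm_natCast]
  have hratio : ((n : ℝ) / Nat.totient n) ^ 5 / n = ((n : ℝ) / Nat.totient n) ^ 4 / Nat.totient n := by
    field_simp
  rw [hratio]
  calc ‖p‖ ^ 2 * (‖χ (n : ZMod D)‖ * ‖lamZero c' D j n‖ / Nat.totient n * ‖A‖ * ‖B‖)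
      ≤ Kp ^ 2 * (1 * ((n : ℝ) / Nat.totient n) ^ 4 / Nat.totient n * KA * KB) := by gcongr
    _ = ((n : ℝ) / Nat.totient n) ^ 4 / Nat.totient n * (Kp ^ 2 * KA * KB) := by ring


/-! ### The engine, III: the masses `Σ (n/φ(n))⁵/n` over the bulk and over the edge windows -/

omit χ in
/-- `Σ_{n ≤ ⌈PT⁻²⌉, n ≥ 2} (n/φ(n))⁵/n ≤ 2e⁶⁴𝓛⁹` (`Skeleton.sum_ratio_pow_div_le`, `1 + log⌈PT⁻²⌉ ≤ 2𝓛⁹`).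
[cite: Zhang2022LandauSiegel, §18 p.100; §7 (7.2)] -/
theorem mass_bulk_le (hL : 2 ≤ ell D) {S : Finset ℕ} (hS : ∀ n ∈ S, 2 ≤ n ∧ n ≤ Nsupp D) :
    ∑ n ∈ S, ((n : ℝ) / Nat.totient n) ^ 5 / n ≤ 2 * Real.exp 64 * ell D ^ 9 := by
  have hsub : S ⊆ Ioc 1 (Nsupp D) := fun n hn => by
    have := hS n hn; rw [mem_Ioc]; omega
  have hN : 1 ≤ Nsupp D := Nat.one_le_iff_ne_zero.mpr (Nat.pos_iff_ne_zero.mp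
    (Nat.ceil_pos.mpr (div_pos (Real.exp_pos _) (pow_pos (Real.exp_pos _) 2))))
  have hW := Skeleton.sum_ratio_pow_div_le 5 one_pos hN
  rw [Nat.cast_one, Real.log_one, sub_zero] at hW
  have h64 : Real.exp (2 ^ (5 + 1)) = Real.exp 64 := by norm_num
  rw [h64] at hW
  have hlogN := Sec18SjNorm.one_add_log_Nsupp_le hL
  calc ∑ n ∈ S, ((n : ℝ) / Nat.totient n) ^ 5 / n
      ≤ ∑ n ∈ Ioc 1 (Nsupp D), ((n : ℝ) / Nat.totient n) ^ 5 / n :=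
        Finset.sum_le_sum_of_subset_of_nonneg hsub fun n _ _ => by positivity
    _ ≤ Real.exp 64 * (1 + Real.log (Nsupp D)) := hW
    _ ≤ Real.exp 64 * (2 * ell D ^ 9) := mul_le_mul_of_nonneg_left hlogN (Real.exp_pos _).le
    _ = 2 * Real.exp 64 * ell D ^ 9 := by ring

omit χ in
/-- The edge windows `(P^c/T, P^c]` (`c ≥ 0.5`) are short: `Σ_{P^c/T < n ≤ P^c} (n/φ(n))⁵/n ≤
e⁶⁴(1 + log 2 + log T) ≤ 2e⁶⁴𝓛²` (`log T = 𝓛^{1.1} ≤ 𝓛²`, `𝓛 ≥ 2`).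
[cite: Zhang2022LandauSiegel, §10 (10.5), (10.11); §18 p.100] -/
theorem mass_window_le (hL : 2 ≤ ell D) {c : ℝ} (hc : 0.5 ≤ c) {S : Finset ℕ}
    (hS : ∀ n ∈ S, bigP D ^ c / bigT D < n ∧ (n : ℝ) ≤ bigP D ^ c) :
    ∑ n ∈ S, ((n : ℝ) / Nat.totient n) ^ 5 / n ≤ 2 * Real.exp 64 * ell D ^ 2 := by
  have hL1 : 1 ≤ ell D := by linarith
  set Q : ℝ := bigP D ^ c with hQ
  have hQpos : 0 < Q := Real.rpow_pos_of_pos (Real.exp_pos _) _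
  have hT1 : 1 ≤ bigT D := by rw [bigT]; exact Real.one_le_exp (Real.rpow_nonneg (ell_nonneg D) _)
  have hTpos : 0 < bigT D := lt_of_lt_of_le one_pos hT1
  have hlogT : Real.log (bigT D) = ell D ^ (1.1 : ℝ) := by rw [bigT, Real.log_exp]
  have hlogQ : Real.log Q = c * ell D ^ 9 := by
    rw [hQ, Real.log_rpow (show 0 < bigP D from Real.exp_pos _), bigP, Real.log_exp]
  have h11 : ell D ^ (1.1 : ℝ) ≤ ell D ^ 2 := by
    have := Real.rpow_le_rpow_of_exponent_le hL1 (show (1.1 : ℝ) ≤ 2 by norm_num)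
    rwa [Real.rpow_two] at this
  have h2 : (4 : ℝ) ≤ ell D ^ 2 := by nlinarith
  -- `Q/T ≥ 2`
  have hQT : 2 ≤ Q / bigT D := by
    have hexp : Q / bigT D = Real.exp (c * ell D ^ 9 - ell D ^ (1.1 : ℝ)) := by
      rw [Real.exp_sub, hQ, bigP, ← Real.exp_mul, bigT]; ring_nf
    rw [hexp]
    have h7 : (2 : ℝ) ^ 7 ≤ ell D ^ 7 := pow_le_pow_left₀ (by norm_num) hL 7
    have hc7 : (64 : ℝ) ≤ c * ell D ^ 7 := by nlinarith [h7, hc]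
    have hA : 64 * ell D ^ 2 ≤ c * ell D ^ 9 := by
      have : c * ell D ^ 9 = c * ell D ^ 7 * ell D ^ 2 := by ring
      rw [this]
      exact mul_le_mul_of_nonneg_right hc7 (by positivity)
    have hge : (1 : ℝ) ≤ c * ell D ^ 9 - ell D ^ (1.1 : ℝ) := by nlinarith [h11, hA, h2]
    calc (2 : ℝ) ≤ Real.exp 1 := by
          have := Real.add_one_le_exp (1 : ℝ); linarith
      _ ≤ Real.exp (c * ell D ^ 9 - ell D ^ (1.1 : ℝ)) := Real.exp_le_exp.mpr hge
  by_cases hSe : S = ∅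
  · rw [hSe, Finset.sum_empty]; positivity
  obtain ⟨n₀, hn₀⟩ := Finset.nonempty_iff_ne_empty.mpr hSe
  set Y : ℕ := ⌊Q / bigT D⌋₊ with hY
  set X : ℕ := ⌊Q⌋₊ with hX
  have hYpos : 0 < Y := Nat.floor_pos.mpr (by linarith)
  have hsub : S ⊆ Ioc Y X := fun n hn => by
    obtain ⟨h1, h2⟩ := hS n hn
    rw [mem_Ioc]
    refine ⟨?_, Nat.le_floor h2⟩
    have : (Y : ℝ) < n := lt_of_le_of_lt (Nat.floor_le (by positivity)) h1
    exact_mod_cast this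
  have hYX : Y ≤ X := by
    have := hsub hn₀; rw [mem_Ioc] at this; omega
  have hW := Skeleton.sum_ratio_pow_div_le 5 hYpos hYX
  have h64 : Real.exp (2 ^ (5 + 1)) = Real.exp 64 := by norm_num
  rw [h64] at hW
  -- `1 + log X − log Y ≤ 2 + 𝓛^{1.1}`
  have hXpos : (0 : ℝ) < X := by
    have := hsub hn₀; rw [mem_Ioc] at this
    exact_mod_cast (show 0 < X by omega)
  have hlogX : Real.log X ≤ Real.log Q :=
    Real.log_le_log hXpos (Nat.floor_le hQpos.le)
  have hYge : Q / (2 * bigT D) ≤ Y := by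
    have hfl : Q / bigT D - 1 ≤ (Y : ℝ) := by
      have := Nat.lt_floor_add_one (Q / bigT D); rw [← hY] at this; linarith
    have : Q / (2 * bigT D) = Q / bigT D - Q / bigT D / 2 := by field_simp; ring
    rw [this]; linarith
  have hlogY : Real.log Q - Real.log 2 - Real.log (bigT D) ≤ Real.log Y := by
    have h := Real.log_le_log (by positivity) hYge
    rw [Real.log_div hQpos.ne' (by positivity), Real.log_mul (by norm_num) hTpos.ne'] at h
    linarith
  have hlog2 : Real.log 2 ≤ 1 := by
    have := Real.log_two_lt_d9; linarith
  calc ∑ n ∈ S, ((n : ℝ) / Nat.totient n) ^ 5 / n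
      ≤ ∑ n ∈ Ioc Y X, ((n : ℝ) / Nat.totient n) ^ 5 / n :=
        Finset.sum_le_sum_of_subset_of_nonneg hsub fun n _ _ => by positivity
    _ ≤ Real.exp 64 * (1 + Real.log X - Real.log Y) := hW
    _ ≤ Real.exp 64 * (2 + ell D ^ 2) := by
        refine mul_le_mul_of_nonneg_left ?_ (Real.exp_pos _).le
        rw [hlogT] at hlogY
        linarith
    _ ≤ 2 * Real.exp 64 * ell D ^ 2 := by
        nlinarith [mul_nonneg (Real.exp_pos 64).le (by linarith : (0 : ℝ) ≤ ell D ^ 2 - 2)]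

/-! ### The engine, IV: a main range `[P^a, P^b)` from its pointwise inputs -/

/-- **The range evaluation from pointwise inputs** (the implicit bookkeeping of "by the discussion
in Section 8 and 10", p.100): on a range `[P^a, P^b)` (`0.5 ≤ a ≤ b ≤ 0.504`), if `𝔳₁ⱼ(n) = pA(n)
+ O(C𝓛⁻¹⁵)` and `𝔳₂ⱼ(d,r) = pΠ(d,r)B(dr) + O(C𝓛⁻¹⁵)` on the bulk `P^a < n ≤ P^b/T` (Lemmas 10.1/10.2,
main clauses) and `𝔳₁ⱼ, 𝔳₂ⱼ = O(C𝓛⁻⁷)` on the edge windows `(P^a/T, P^a]`, `(P^b/T, P^b)` ((10.5),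
(10.11)), then `Sj23Range(P^a, P^b) = p²Σ_{P^a ≤ n < P^b}|χ(n)|λ₀ⱼ(n)/φ(n)A(n)B(n)` up to the
displayed explicit error (bulk mass `2e⁶⁴𝓛⁹`, window masses `2e⁶⁴𝓛²`).
[cite: Zhang2022LandauSiegel, §18 p.100; §10 Lemmas 10.1–10.2] -/
theorem range_estimate [NeZero D] (hq : χ.IsQuadratic) (hL : 2 ≤ ell D) (j : ℕ) {a b : ℝ}
    (ha : 0.5 ≤ a) (hab : a ≤ b) (hb : b ≤ 0.504) (A B : ℕ → ℂ) (p : ℂ)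
    {C KA KB Kp : ℝ} (hC : 0 ≤ C) (hKA : 0 ≤ KA) (hKB : 0 ≤ KB) (hKp : 0 ≤ Kp) (hp : ‖p‖ ≤ Kp)
    (hAB : ∀ n : ℕ, bigP D ^ a ≤ n → (n : ℝ) < bigP D ^ b → ‖A n‖ ≤ KA ∧ ‖B n‖ ≤ KB)
    (h1m : ∀ n : ℕ, bigP D ^ a < n → (n : ℝ) ≤ bigP D ^ b / bigT D →
      ‖frakv1 c' χ j n - p * A n‖ ≤ C / ell D ^ 15)
    (h2m : ∀ n : ℕ, bigP D ^ a < n → (n : ℝ) ≤ bigP D ^ b / bigT D →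
      ∀ r ∈ n.divisors, Squarefree r →
        ‖frakv2 c' χ j (n / r) r - p * PiW χ (n / r) r * B n‖ ≤ C / ell D ^ 15)
    (h1w : ∀ n : ℕ, (bigP D ^ a / bigT D < n ∧ (n : ℝ) ≤ bigP D ^ a) ∨
        (bigP D ^ b / bigT D < n ∧ (n : ℝ) < bigP D ^ b) → ‖frakv1 c' χ j n‖ ≤ C / ell D ^ 7)
    (h2w : ∀ n : ℕ, (bigP D ^ a / bigT D < n ∧ (n : ℝ) ≤ bigP D ^ a) ∨
        (bigP D ^ b / bigT D < n ∧ (n : ℝ) < bigP D ^ b) →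
      ∀ r ∈ n.divisors, Squarefree r → ‖frakv2 c' χ j (n / r) r‖ ≤ C / ell D ^ 7) :
    ‖Sj23Range c' χ j (bigP D ^ a) (bigP D ^ b) -
        p ^ 2 * ∑ n ∈ (Ico 1 (Nsupp D)).filter
            (fun n : ℕ => bigP D ^ a ≤ (n : ℝ) ∧ (n : ℝ) < bigP D ^ b),
          ((‖χ (n : ZMod D)‖ : ℝ) : ℂ) * lamZero c' D j n / (Nat.totient n : ℂ) * A n * B n‖ ≤
      2 * Real.exp 64 * ell D ^ 9 * (C / ell D ^ 15 * (Kp * (KA + KB) + C / ell D ^ 15)) +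
        2 * (2 * Real.exp 64 * ell D ^ 2) * ((C / ell D ^ 7) ^ 2 + Kp ^ 2 * KA * KB) := by
  classical
  have hL' : 2 ≤ Real.log D := hL
  have hL0 : 0 < ell D := by linarith
  have hP1 : 1 ≤ bigP D := by rw [bigP]; exact Real.one_le_exp (pow_nonneg (ell_nonneg D) 9)
  have hPa1 : 1 < bigP D ^ a := by
    rw [bigP, ← Real.exp_mul]
    exact Real.one_lt_exp_iff.mpr (by positivity)
  have hT1 : 1 < bigT D := by rw [bigT]; exact Real.one_lt_exp_iff.mpr (by positivity)
  have hb' : bigP D ^ b ≤ Skeleton.P1 D := Real.rpow_le_rpow_of_exponent_le hP1 hb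
  set δ : ℝ := C / ell D ^ 15 with hδ
  set δ₇ : ℝ := C / ell D ^ 7 with hδ₇
  have hδ0 : 0 ≤ δ := by positivity
  have hδ₇0 : 0 ≤ δ₇ := by positivity
  set cM : ℝ := δ * (Kp * (KA + KB) + δ) with hcM
  set cW : ℝ := δ₇ ^ 2 + Kp ^ 2 * KA * KB with hcW
  set F := (Ico 1 (Nsupp D)).filter (fun n : ℕ => bigP D ^ a ≤ (n : ℝ) ∧ (n : ℝ) < bigP D ^ b)
    with hF
  rw [Sj23Range_eq_sum_divisors c' χ hL j hb', Finset.mul_sum, ← Finset.sum_sub_distrib]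
  -- pointwise bound
  have hpt : ∀ n ∈ F, ‖(∑ r ∈ n.divisors, sj23Term c' χ j r (n / r)) -
      p ^ 2 * (((‖χ (n : ZMod D)‖ : ℝ) : ℂ) * lamZero c' D j n / (Nat.totient n : ℂ) * A n * B n)‖ ≤
      if bigP D ^ a < (n : ℝ) ∧ (n : ℝ) ≤ bigP D ^ b / bigT D then
        ((n : ℝ) / Nat.totient n) ^ 5 / n * cM else ((n : ℝ) / Nat.totient n) ^ 5 / n * cW := by
    intro n hn
    rw [hF, mem_filter, mem_Ico] at hn
    obtain ⟨⟨hn1, -⟩, hna, hnb⟩ := hn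
    obtain ⟨hAn, hBn⟩ := hAB n hna hnb
    rw [sum_divisors_sj23Term_eq c' χ hL j hn1]
    split_ifs with hmain
    · exact perN_main c' χ hq j hn1 hδ0 hKp hAn hBn hp (h1m n hmain.1 hmain.2)
        (h2m n hmain.1 hmain.2)
    · have hwin : (bigP D ^ a / bigT D < n ∧ (n : ℝ) ≤ bigP D ^ a) ∨
          (bigP D ^ b / bigT D < n ∧ (n : ℝ) < bigP D ^ b) := by
        rcases not_and_or.mp hmain with h | h
        · exact Or.inl ⟨lt_of_lt_of_le (div_lt_self (by linarith) hT1) hna, not_lt.mp h⟩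
        · exact Or.inr ⟨not_le.mp h, hnb⟩
      calc _ ≤ ‖((‖χ (n : ZMod D)‖ : ℝ) : ℂ) * lamZero c' D j n / (n : ℂ) * frakv1 c' χ j (n : ℝ) *
              (∑ r ∈ n.divisors with Squarefree r, frakv2 c' χ j (n / r) r / (Nat.totient r : ℂ))‖ +
            ‖p ^ 2 * (((‖χ (n : ZMod D)‖ : ℝ) : ℂ) * lamZero c' D j n / (Nat.totient n : ℂ) *
              A n * B n)‖ := norm_sub_le _ _
        _ ≤ ((n : ℝ) / Nat.totient n) ^ 5 / n * (δ₇ * δ₇) +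
            ((n : ℝ) / Nat.totient n) ^ 5 / n * (Kp ^ 2 * KA * KB) :=
          add_le_add (perN_window c' χ j hn1 hδ₇0 (h1w n hwin) (h2w n hwin))
            (perN_mainTerm_le c' χ j hn1 hAn hBn hp)
        _ = ((n : ℝ) / Nat.totient n) ^ 5 / n * cW := by rw [hcW]; ring
  refine (norm_sum_le _ _).trans ((Finset.sum_le_sum hpt).trans ?_)
  rw [Finset.sum_ite, ← Finset.sum_mul, ← Finset.sum_mul]
  -- the bulk
  have hbulk : ∑ n ∈ F.filter (fun n : ℕ => bigP D ^ a < (n : ℝ) ∧ (n : ℝ) ≤ bigP D ^ b / bigT D),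
      ((n : ℝ) / Nat.totient n) ^ 5 / n ≤ 2 * Real.exp 64 * ell D ^ 9 := by
    refine mass_bulk_le hL fun n hn => ?_
    rw [mem_filter, hF, mem_filter, mem_Ico] at hn
    obtain ⟨⟨⟨_, hnN⟩, hna, _⟩, _, _⟩ := hn
    refine ⟨?_, hnN.le⟩
    have : (1 : ℝ) < n := lt_of_lt_of_le hPa1 hna
    have : 1 < n := by exact_mod_cast this
    omega
  -- the windows
  have hwin : ∑ n ∈ F.filter (fun n : ℕ => ¬(bigP D ^ a < (n : ℝ) ∧ (n : ℝ) ≤ bigP D ^ b / bigT D)),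
      ((n : ℝ) / Nat.totient n) ^ 5 / n ≤ 2 * (2 * Real.exp 64 * ell D ^ 2) := by
    rw [← Finset.sum_filter_add_sum_filter_not _ (fun n : ℕ => (n : ℝ) ≤ bigP D ^ a), two_mul]
    refine add_le_add ?_ ?_
    · refine mass_window_le hL (c := a) ha fun n hn => ?_
      rw [mem_filter, mem_filter, hF, mem_filter] at hn
      obtain ⟨⟨⟨_, hna, _⟩, _⟩, hle⟩ := hn
      exact ⟨lt_of_lt_of_le (div_lt_self (by linarith) hT1) hna, hle⟩
    · refine mass_window_le hL (c := b) (by linarith) fun n hn => ?_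
      rw [mem_filter, mem_filter, hF, mem_filter] at hn
      obtain ⟨⟨⟨_, _, hnb⟩, hnot⟩, hle⟩ := hn
      refine ⟨?_, hnb.le⟩
      rcases not_and_or.mp hnot with h | h
      · exact absurd (not_le.mp hle) h
      · exact not_le.mp h
  have hcM0 : 0 ≤ cM := by positivity
  have hcW0 : 0 ≤ cW := by positivity
  exact add_le_add (mul_le_mul_of_nonneg_right hbulk hcM0 |>.trans_eq (by ring))
    (mul_le_mul_of_nonneg_right hwin hcW0 |>.trans_eq (by ring))

end Engine

/-! ### The two main ranges: `Z22:§18.u010` and `Z22:§18.u011` (reading `𝒴₂ⱼ`) from Lemmas 10.1–10.2 -/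

section MainRanges

variable {D : ℕ}

/-- The final numerics of a main range: with `K_p = k𝓛⁻⁷` the explicit error of `range_estimate` is
`≤ M𝓛⁻¹²` (`𝓛 ≥ 1`), hence `≤ εα = επ𝓛⁻⁹` once `𝓛 ≥ M/(επ)`. [folklore] -/
private theorem numeric_bound {L ε C k KA KB : ℝ} (hL1 : 1 ≤ L) (hε : 0 < ε) (hC : 0 ≤ C)
    (hk : 0 ≤ k) (hKA : 0 ≤ KA) (hKB : 0 ≤ KB)
    (hM : (2 * Real.exp 64 * C * k * (KA + KB) + 6 * Real.exp 64 * C ^ 2 +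
      4 * Real.exp 64 * k ^ 2 * KA * KB) / (ε * π) ≤ L) :
    2 * Real.exp 64 * L ^ 9 * (C / L ^ 15 * (k / L ^ 7 * (KA + KB) + C / L ^ 15)) +
        2 * (2 * Real.exp 64 * L ^ 2) * ((C / L ^ 7) ^ 2 + (k / L ^ 7) ^ 2 * KA * KB) ≤
      ε * (π / L ^ 9) := by
  have hL0 : 0 < L := by linarith
  set M : ℝ := 2 * Real.exp 64 * C * k * (KA + KB) + 6 * Real.exp 64 * C ^ 2 +
    4 * Real.exp 64 * k ^ 2 * KA * KB with hMdef
  have hpow : ∀ {X : ℝ} (m : ℕ), 0 ≤ X → 12 ≤ m → X / L ^ m ≤ X / L ^ 12 := by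
    intro X m hX hm
    exact div_le_div_of_nonneg_left hX (by positivity) (pow_le_pow_right₀ hL1 hm)
  have hE : 2 * Real.exp 64 * L ^ 9 * (C / L ^ 15 * (k / L ^ 7 * (KA + KB) + C / L ^ 15)) +
        2 * (2 * Real.exp 64 * L ^ 2) * ((C / L ^ 7) ^ 2 + (k / L ^ 7) ^ 2 * KA * KB) =
      2 * Real.exp 64 * C * k * (KA + KB) / L ^ 13 + 2 * Real.exp 64 * C ^ 2 / L ^ 21 +
        4 * Real.exp 64 * C ^ 2 / L ^ 12 + 4 * Real.exp 64 * k ^ 2 * KA * KB / L ^ 12 := by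
    field_simp
    ring
  rw [hE]
  have hKle : M ≤ ε * π * L := by
    have := (div_le_iff₀ (by positivity : (0 : ℝ) < ε * π)).mp hM
    linarith
  calc 2 * Real.exp 64 * C * k * (KA + KB) / L ^ 13 + 2 * Real.exp 64 * C ^ 2 / L ^ 21 +
        4 * Real.exp 64 * C ^ 2 / L ^ 12 + 4 * Real.exp 64 * k ^ 2 * KA * KB / L ^ 12
      ≤ 2 * Real.exp 64 * C * k * (KA + KB) / L ^ 12 + 2 * Real.exp 64 * C ^ 2 / L ^ 12 +
        4 * Real.exp 64 * C ^ 2 / L ^ 12 + 4 * Real.exp 64 * k ^ 2 * KA * KB / L ^ 12 := by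
        gcongr ?_ + ?_ + _ + _
        · exact hpow 13 (by positivity) (by norm_num)
        · exact hpow 21 (by positivity) (by norm_num)
    _ = M / L ^ 12 := by rw [hMdef]; field_simp; ring
    _ ≤ ε * (π / L ^ 9) := by
        rw [div_le_iff₀ (by positivity)]
        calc M ≤ ε * π * L := hKle
          _ ≤ ε * π * L ^ 3 := by
              gcongr
              exact le_self_pow₀ hL1 (by norm_num)
          _ = ε * (π / L ^ 9) * L ^ 12 := by
              field_simp

/-- `|𝒴₂ⱼ(n)| ≤ 4β₀ + 6β₀²` on `[1, ⌈PT⁻²⌉)` (`β₀ = 3π(1+5|c′|)`, `𝓛 ≥ 2`), the analogue for (10.10)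
of `Sec18SjNorm.norm_fraky1_le`. [cite: Zhang2022LandauSiegel, §10 (10.10)] -/
theorem norm_fraky2_le (hL : 2 ≤ ell D) (j : ℕ) {n : ℕ} (hn : n ∈ Ico 1 (Nsupp D)) :
    ‖fraky2 c' D j n‖ ≤ 4 * (3 * π * (1 + 5 * |c'|)) + 6 * (3 * π * (1 + 5 * |c'|)) ^ 2 := by
  set b : ℝ := 3 * π * (1 + 5 * |c'|) with hb
  have hb0 : 0 ≤ b := by positivity
  have hℓ : 0 < ell D := by linarith
  have hL90 : 0 < ell D ^ 9 := by positivity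
  have hβ1 : ‖betaJ c' D (j + 1)‖ ≤ b / ell D ^ 9 := Sec18SjNorm.norm_betaJ_le_div c' hL (j + 1)
  have hβ2 : ‖betaJ c' D (j + 2)‖ ≤ b / ell D ^ 9 := Sec18SjNorm.norm_betaJ_le_div c' hL (j + 2)
  have hl := (Sec18SjNorm.abs_log_div_rpow_le hL hn (a := 0.504) (by norm_num) (by norm_num)).2
  set x : ℝ := Real.log (bigP D ^ (0.504 : ℝ) / (n : ℝ)) with hx
  have hxC : ‖(x : ℂ)‖ = |x| := by rw [Complex.norm_real, Real.norm_eq_abs]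
  rw [fraky2]
  calc ‖(betaJ c' D (j + 1) + betaJ c' D (j + 2)) * (x : ℂ) +
        betaJ c' D (j + 1) * betaJ c' D (j + 2) / 2 * (x : ℂ) ^ 2‖
      ≤ ‖(betaJ c' D (j + 1) + betaJ c' D (j + 2)) * (x : ℂ)‖ +
        ‖betaJ c' D (j + 1) * betaJ c' D (j + 2) / 2 * (x : ℂ) ^ 2‖ := norm_add_le _ _
    _ ≤ (b / ell D ^ 9 + b / ell D ^ 9) * (2 * ell D ^ 9) +
        (b / ell D ^ 9) * (b / ell D ^ 9) / 2 * (2 * ell D ^ 9) ^ 2 := by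
        refine add_le_add ?_ ?_
        · rw [norm_mul, hxC]
          exact mul_le_mul ((norm_add_le _ _).trans (add_le_add hβ1 hβ2)) hl (abs_nonneg _)
            (by positivity)
        · rw [norm_mul, norm_div, norm_mul, norm_pow, hxC, Complex.norm_two]
          refine mul_le_mul (by gcongr) (pow_le_pow_left₀ (abs_nonneg _) hl 2) (by positivity)
            (by positivity)
    _ = 4 * b + 2 * b ^ 2 := by field_simp; ring
    _ ≤ 4 * b + 6 * b ^ 2 := by nlinarith

/-- `C₁(𝓛ᵐ)⁻¹ ≤ C/𝓛ᵐ` for `C₁ ≤ C`. [folklore] -/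
private theorem mul_inv_le_div {C₁ C L : ℝ} (m : ℕ) (h : C₁ ≤ C) (hL : 0 ≤ L) :
    C₁ * (L ^ m)⁻¹ ≤ C / L ^ m := by
  rw [div_eq_mul_inv]
  exact mul_le_mul_of_nonneg_right h (inv_nonneg.mpr (pow_nonneg hL m))

/-- Membership in `[1, ⌈PT⁻²⌉)` of the integers of a range `[P^a, P^b)`, `0 ≤ a`, `b ≤ 0.504`.
[cite: Zhang2022LandauSiegel, §7 (7.2)] -/
theorem mem_Ico_Nsupp_of_range (hL : 2 ≤ ell D) {a b : ℝ} (ha : 0 ≤ a) (hb : b ≤ 0.504) {n : ℕ}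
    (hna : bigP D ^ a ≤ n) (hnb : (n : ℝ) < bigP D ^ b) : n ∈ Ico 1 (Nsupp D) := by
  have hL' : 2 ≤ Real.log D := hL
  have hP1 : 1 ≤ bigP D := by rw [bigP]; exact Real.one_le_exp (pow_nonneg (ell_nonneg D) 9)
  rw [mem_Ico]
  constructor
  · have : (1 : ℝ) ≤ n := le_trans (one_le_Ppow D ha) hna
    exact_mod_cast this
  · by_contra h
    have h1 := Skeleton.P1_lt_of_Nsupp_le D hL' (not_lt.mp h)
    have h2 : bigP D ^ b ≤ Skeleton.P1 D := Real.rpow_le_rpow_of_exponent_le hP1 hb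
    linarith

/-- `‖500L′(1,χ)/log P‖ ≤ 2000e^{4.5}𝓛⁻⁷` (`χ` primitive, `𝓛 ≥ 3`; `Sec18SjNorm.norm_prefactor_sq_le`).
[cite: Zhang2022LandauSiegel, §18 p.100] -/
theorem norm_prefactor_le [NeZero D] (χ : DirichletCharacter ℂ D) (hL : 3 ≤ ell D)
    (hp : χ.IsPrimitive) :
    ‖500 * deriv χ.LFunction 1 / (Real.log (bigP D) : ℂ)‖ ≤ 2000 * Real.exp 4.5 / ell D ^ 7 := by
  have h := Sec18SjNorm.norm_prefactor_sq_le χ hL hp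
  have hL0 : 0 < ell D := by linarith
  have heq : (2000 * Real.exp 4.5 / ell D ^ 7) ^ 2 = 4e6 * Real.exp 9 / ell D ^ 14 := by
    rw [div_pow, mul_pow, ← Real.exp_nat_mul]
    norm_num
    ring
  rw [← heq] at h
  exact (pow_le_pow_iff_left₀ (norm_nonneg _) (by positivity) two_ne_zero).mp h

/-- **Kernel edge `Z22:§18.u010 ⇐ Lemma 10.1 + Lemma 10.2`**: "the sum over `P^{0.5} ≤ dr < P^{0.502}`
is equal to `(500L′(1,χ)/log P)² Σ_{P^{0.5} ≤ n < P^{0.502}} |χ(n)|λ₀ⱼ(n)/φ(n)(−1 − β_j log(n/P^{0.5}))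
(−1 + 𝒴₁ⱼ(n)) + o(α)`" (Z22 p.100, tex L4932–L4937) FOLLOWS from the banked nodes
`Skeleton.Lemma101 c′` ((10.3), (10.5)) and `Skeleton.Lemma102 c′` ((10.9), (10.11)) by the
bookkeeping of `range_estimate` ((8.10) and the crude majorants; error `O_{c′}(𝓛⁻¹²) = o(α)`).
[cite: Zhang2022LandauSiegel, §18 p.100; §10 Lemmas 10.1–10.2] -/
theorem step18_u010_of (h101 : Skeleton.Lemma101 c') (h102 : Skeleton.Lemma102 c') :
    Step18_u010 c' := by
  intro ε hε
  obtain ⟨c, _, C₁, D₁, h1⟩ := h101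
  obtain ⟨C₂, D₂, h2⟩ := h102
  set C : ℝ := max (max C₁ C₂) 0 with hCdef
  have hC0 : 0 ≤ C := le_max_right _ _
  have hC1 : C₁ ≤ C := le_trans (le_max_left _ _) (le_max_left _ _)
  have hC2 : C₂ ≤ C := le_trans (le_max_right _ _) (le_max_left _ _)
  set b : ℝ := 3 * π * (1 + 5 * |c'|) with hb
  have hb0 : 0 ≤ b := by positivity
  set KA : ℝ := 1 + 2 * b with hKA
  set KB : ℝ := 1 + (4 * b + 6 * b ^ 2) with hKB
  have hKA0 : 0 ≤ KA := by positivity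
  have hKB0 : 0 ≤ KB := by positivity
  set k : ℝ := 2000 * Real.exp 4.5 with hk
  have hk0 : 0 ≤ k := by positivity
  set M : ℝ := 2 * Real.exp 64 * C * k * (KA + KB) + 6 * Real.exp 64 * C ^ 2 +
    4 * Real.exp 64 * k ^ 2 * KA * KB with hM
  obtain ⟨D₉, hD₉⟩ := exists_ell_ge (max 3 (M / (ε * π)))
  refine ⟨max (max D₁ D₂) D₉, fun D _ χ hD hq hp hA j hj => ?_⟩
  have hD1 : D₁ ≤ D := le_trans (le_trans (le_max_left _ _) (le_max_left _ _)) hD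
  have hD2 : D₂ ≤ D := le_trans (le_trans (le_max_right _ _) (le_max_left _ _)) hD
  have hℓ : max 3 (M / (ε * π)) ≤ ell D := hD₉ D (le_trans (le_max_right _ _) hD)
  have hL3 : 3 ≤ ell D := le_trans (le_max_left _ _) hℓ
  have hML : M / (ε * π) ≤ ell D := le_trans (le_max_right _ _) hℓ
  have hL1 : 1 ≤ ell D := by linarith
  have hL2 : 2 ≤ ell D := by linarith
  have hL0 : 0 ≤ ell D := by linarith
  have h1D := h1 D χ hD1 hq hp hA j hj
  have h2D := h2 D χ hD2 hq hp hA j hj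
  have hpK := norm_prefactor_le χ hL3 hp
  have hR := range_estimate c' χ hq hL2 j (a := 0.5) (b := 0.502) (by norm_num) (by norm_num)
    (by norm_num) (fun n : ℕ => -1 - betaJ c' D j * (Real.log ((n : ℝ) / bigP D ^ (0.5 : ℝ)) : ℂ))
    (fun n : ℕ => -1 + fraky1 c' D j n) (500 * deriv χ.LFunction 1 / (Real.log (bigP D) : ℂ))
    hC0 hKA0 hKB0 (by positivity) hpK ?_ ?_ ?_ ?_ ?_
  · rw [alpha_eq]
    exact hR.trans (numeric_bound hL1 hε hC0 hk0 hKA0 hKB0 hML)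
  · -- the factor bounds
    intro n hna hnb
    have hnI := mem_Ico_Nsupp_of_range hL2 (by norm_num) (by norm_num) hna hnb
    have hf := Sec18SjNorm.norm_factors_le c' hL2 j hnI
    exact ⟨hf.1, hf.2.2.1⟩
  · -- Lemma 10.1, (10.3)
    intro n hlo hhi
    exact ((h1D n).2.1 hlo hhi).trans (mul_inv_le_div 15 hC1 hL0)
  · -- Lemma 10.2, (10.9)
    intro n hlo hhi r hr _
    have hn1 : 1 ≤ n := by
      have : (1 : ℝ) ≤ n := le_trans (one_le_Ppow D (by norm_num)) hlo.le
      exact_mod_cast this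
    have hrn : r ∣ n := Nat.dvd_of_mem_divisors hr
    have hr1 : 1 ≤ r := Nat.pos_of_dvd_of_pos hrn (by omega)
    have hd1 : 1 ≤ n / r := Nat.div_pos (Nat.le_of_dvd (by omega) hrn) (by omega)
    have h := (h2D (n / r) r hd1 hr1).2.1
    rw [Nat.div_mul_cancel hrn] at h
    have h' := h hlo hhi
    have e : 500 * deriv χ.LFunction 1 * PiW χ (n / r) r / (Real.log (bigP D) : ℂ) *
        (-1 + fraky1 c' D j (n : ℝ)) =
        500 * deriv χ.LFunction 1 / (Real.log (bigP D) : ℂ) * PiW χ (n / r) r *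
          (-1 + fraky1 c' D j n) := by ring
    rw [e] at h'
    exact h'.trans (mul_inv_le_div 15 hC2 hL0)
  · -- Lemma 10.1, (10.5)
    intro n hw
    refine ((h1D n).2.2.2 ?_).trans (mul_inv_le_div 7 hC1 hL0)
    rcases hw with h | h
    · exact Or.inl h
    · exact Or.inr (Or.inl ⟨h.1, h.2.le⟩)
  · -- Lemma 10.2, (10.11)
    intro n hw r hr _
    have hn1 : 1 ≤ n := by
      have hT1 : 1 < bigT D := by rw [bigT]; exact Real.one_lt_exp_iff.mpr (by positivity)
      have hlow : bigP D ^ (0.5 : ℝ) / bigT D < n := by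
        rcases hw with h | h
        · exact h.1
        · refine lt_trans ?_ h.1
          exact div_lt_div_of_pos_right (Real.rpow_lt_rpow_of_exponent_lt
            (by rw [bigP]; exact Real.one_lt_exp_iff.mpr (by positivity)) (by norm_num))
            (by linarith)
      have h1 : (1 : ℝ) ≤ bigP D ^ (0.5 : ℝ) / bigT D := by
        rw [le_div_iff₀ (by linarith), one_mul, bigT, bigP, ← Real.exp_mul]
        refine Real.exp_le_exp.mpr ?_
        have h11 : ell D ^ (1.1 : ℝ) ≤ ell D ^ 2 := by
          have := Real.rpow_le_rpow_of_exponent_le hL1 (show (1.1 : ℝ) ≤ 2 by norm_num)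
          rwa [Real.rpow_two] at this
        have h7 : (2 : ℝ) ^ 7 ≤ ell D ^ 7 := pow_le_pow_left₀ (by norm_num) hL2 7
        nlinarith
      have : (1 : ℝ) ≤ n := le_trans h1 hlow.le
      exact_mod_cast this
    have hrn : r ∣ n := Nat.dvd_of_mem_divisors hr
    have hr1 : 1 ≤ r := Nat.pos_of_dvd_of_pos hrn (by omega)
    have hd1 : 1 ≤ n / r := Nat.div_pos (Nat.le_of_dvd (by omega) hrn) (by omega)
    have h := (h2D (n / r) r hd1 hr1).2.2.2
    rw [Nat.div_mul_cancel hrn] at h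
    refine (h ?_).trans (mul_inv_le_div 7 hC2 hL0)
    rcases hw with h | h
    · exact Or.inl h
    · exact Or.inr (Or.inl ⟨h.1, h.2.le⟩)


omit c' in
/-- `1 ≤ n` for an integer beyond the left end `P^a/T` of a window, `a ≥ 0.5`, `𝓛 ≥ 2`
(`P^{0.5}/T = exp(𝓛⁹/2 − 𝓛^{1.1}) ≥ 1`). [cite: Zhang2022LandauSiegel, §10 (10.5)] -/
theorem one_le_of_window (hL : 2 ≤ ell D) {a : ℝ} (ha : 0.5 ≤ a) {n : ℕ}
    (h : bigP D ^ a / bigT D < n) : 1 ≤ n := by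
  have hL1 : 1 ≤ ell D := by linarith
  have hT0 : 0 < bigT D := Real.exp_pos _
  have hmono : bigP D ^ (0.5 : ℝ) / bigT D ≤ bigP D ^ a / bigT D :=
    div_le_div_of_nonneg_right (Real.rpow_le_rpow_of_exponent_le
      (by rw [bigP]; exact Real.one_le_exp (pow_nonneg (ell_nonneg D) 9)) ha) hT0.le
  have h1 : (1 : ℝ) ≤ bigP D ^ (0.5 : ℝ) / bigT D := by
    rw [le_div_iff₀ hT0, one_mul, bigT, bigP, ← Real.exp_mul]
    refine Real.exp_le_exp.mpr ?_
    have h11 : ell D ^ (1.1 : ℝ) ≤ ell D ^ 2 := by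
      have := Real.rpow_le_rpow_of_exponent_le hL1 (show (1.1 : ℝ) ≤ 2 by norm_num)
      rwa [Real.rpow_two] at this
    have h7 : (2 : ℝ) ^ 7 ≤ ell D ^ 7 := pow_le_pow_left₀ (by norm_num) hL 7
    nlinarith
  have : (1 : ℝ) ≤ n := le_trans h1 (le_trans hmono h.le)
  exact_mod_cast this

/-- **Kernel edge `Z22:§18.u011` (READING `𝒴₂ⱼ` of (10.10)) `⇐ Lemma 10.1 + Lemma 10.2`**: "the sum
over `P^{0.502} ≤ dr < P^{0.504}` is equal to `(500L′(1,χ)/log P)² Σ_{P^{0.502} ≤ n < P^{0.504}}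
|χ(n)|λ₀ⱼ(n)/φ(n)(1 − β_j log(P^{0.504}/n))(1 + 𝒴₂ⱼ(n)) + o(α)`" — the typed reading
`Step18_u011b` (Z22 p.100, tex L4938–L4942 with (10.10)) FOLLOWS from `Skeleton.Lemma101 c′`
((10.4), (10.5)) and `Skeleton.Lemma102 c′` ((10.10), (10.11)) by `range_estimate`. The PRINTED
display (`Step18_u011`, factor `1 + 𝒴₁ⱼ(n)`) is not what (10.10) delivers on this range; see the
module docstring. [cite: Zhang2022LandauSiegel, §18 p.100; §10 Lemmas 10.1–10.2] -/
theorem step18_u011b_of (h101 : Skeleton.Lemma101 c') (h102 : Skeleton.Lemma102 c') :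
    Step18_u011b c' := by
  intro ε hε
  obtain ⟨c, _, C₁, D₁, h1⟩ := h101
  obtain ⟨C₂, D₂, h2⟩ := h102
  set C : ℝ := max (max C₁ C₂) 0 with hCdef
  have hC0 : 0 ≤ C := le_max_right _ _
  have hC1 : C₁ ≤ C := le_trans (le_max_left _ _) (le_max_left _ _)
  have hC2 : C₂ ≤ C := le_trans (le_max_right _ _) (le_max_left _ _)
  set b : ℝ := 3 * π * (1 + 5 * |c'|) with hb
  have hb0 : 0 ≤ b := by positivity
  set KA : ℝ := 1 + 2 * b with hKA
  set KB : ℝ := 1 + (4 * b + 6 * b ^ 2) with hKB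
  have hKA0 : 0 ≤ KA := by positivity
  have hKB0 : 0 ≤ KB := by positivity
  set k : ℝ := 2000 * Real.exp 4.5 with hk
  have hk0 : 0 ≤ k := by positivity
  set M : ℝ := 2 * Real.exp 64 * C * k * (KA + KB) + 6 * Real.exp 64 * C ^ 2 +
    4 * Real.exp 64 * k ^ 2 * KA * KB with hM
  obtain ⟨D₉, hD₉⟩ := exists_ell_ge (max 3 (M / (ε * π)))
  refine ⟨max (max D₁ D₂) D₉, fun D _ χ hD hq hp hA j hj => ?_⟩
  have hD1 : D₁ ≤ D := le_trans (le_trans (le_max_left _ _) (le_max_left _ _)) hD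
  have hD2 : D₂ ≤ D := le_trans (le_trans (le_max_right _ _) (le_max_left _ _)) hD
  have hℓ : max 3 (M / (ε * π)) ≤ ell D := hD₉ D (le_trans (le_max_right _ _) hD)
  have hL3 : 3 ≤ ell D := le_trans (le_max_left _ _) hℓ
  have hML : M / (ε * π) ≤ ell D := le_trans (le_max_right _ _) hℓ
  have hL1 : 1 ≤ ell D := by linarith
  have hL2 : 2 ≤ ell D := by linarith
  have hL0 : 0 ≤ ell D := by linarith
  have h1D := h1 D χ hD1 hq hp hA j hj
  have h2D := h2 D χ hD2 hq hp hA j hj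
  have hpK := norm_prefactor_le χ hL3 hp
  have hR := range_estimate c' χ hq hL2 j (a := 0.502) (b := 0.504) (by norm_num) (by norm_num)
    (by norm_num) (fun n : ℕ => 1 - betaJ c' D j * (Real.log (bigP D ^ (0.504 : ℝ) / n) : ℂ))
    (fun n : ℕ => 1 + fraky2 c' D j n) (500 * deriv χ.LFunction 1 / (Real.log (bigP D) : ℂ))
    hC0 hKA0 hKB0 (by positivity) hpK ?_ ?_ ?_ ?_ ?_
  · rw [alpha_eq]
    exact hR.trans (numeric_bound hL1 hε hC0 hk0 hKA0 hKB0 hML)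
  · -- the factor bounds
    intro n hna hnb
    have hnI := mem_Ico_Nsupp_of_range hL2 (by norm_num) (by norm_num) hna hnb
    have hf := Sec18SjNorm.norm_factors_le c' hL2 j hnI
    refine ⟨hf.2.1, ?_⟩
    calc ‖(1 + fraky2 c' D j n)‖ ≤ ‖(1 : ℂ)‖ + ‖fraky2 c' D j n‖ := norm_add_le _ _
      _ ≤ 1 + (4 * b + 6 * b ^ 2) := by
          rw [norm_one]; exact add_le_add le_rfl (norm_fraky2_le c' hL2 j hnI)
  · -- Lemma 10.1, (10.4)
    intro n hlo hhi
    exact ((h1D n).2.2.1 hlo hhi).trans (mul_inv_le_div 15 hC1 hL0)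
  · -- Lemma 10.2, (10.10)
    intro n hlo hhi r hr _
    have hn1 : 1 ≤ n := by
      have : (1 : ℝ) ≤ n := le_trans (one_le_Ppow D (by norm_num)) hlo.le
      exact_mod_cast this
    have hrn : r ∣ n := Nat.dvd_of_mem_divisors hr
    have hr1 : 1 ≤ r := Nat.pos_of_dvd_of_pos hrn (by omega)
    have hd1 : 1 ≤ n / r := Nat.div_pos (Nat.le_of_dvd (by omega) hrn) (by omega)
    have h := (h2D (n / r) r hd1 hr1).2.2.1
    rw [Nat.div_mul_cancel hrn] at h
    have h' := h hlo hhi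
    have e : 500 * deriv χ.LFunction 1 * PiW χ (n / r) r / (Real.log (bigP D) : ℂ) *
        (1 + fraky2 c' D j (n : ℝ)) =
        500 * deriv χ.LFunction 1 / (Real.log (bigP D) : ℂ) * PiW χ (n / r) r *
          (1 + fraky2 c' D j n) := by ring
    rw [e] at h'
    exact h'.trans (mul_inv_le_div 15 hC2 hL0)
  · -- Lemma 10.1, (10.5)
    intro n hw
    refine ((h1D n).2.2.2 ?_).trans (mul_inv_le_div 7 hC1 hL0)
    rcases hw with h | h
    · exact Or.inr (Or.inl h)
    · exact Or.inr (Or.inr h)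
  · -- Lemma 10.2, (10.11)
    intro n hw r hr _
    have hn1 : 1 ≤ n := by
      rcases hw with h | h
      · exact one_le_of_window hL2 (by norm_num) h.1
      · exact one_le_of_window hL2 (by norm_num) h.1
    have hrn : r ∣ n := Nat.dvd_of_mem_divisors hr
    have hr1 : 1 ≤ r := Nat.pos_of_dvd_of_pos hrn (by omega)
    have hd1 : 1 ≤ n / r := Nat.div_pos (Nat.le_of_dvd (by omega) hrn) (by omega)
    have h := (h2D (n / r) r hd1 hr1).2.2.2
    rw [Nat.div_mul_cancel hrn] at h
    refine (h ?_).trans (mul_inv_le_div 7 hC2 hL0)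
    rcases hw with h | h
    · exact Or.inr (Or.inl h)
    · exact Or.inr (Or.inr h)

/-- `Z22:§18.u010` from Lemma 10.2 alone for `c′ ≥ 0` (Lemma 10.1 is DISCHARGED in the tree:
`Skeleton.lemma101_holds`). [cite: Zhang2022LandauSiegel, §18 p.100; §10 Lemmas 10.1–10.2] -/
theorem step18_u010_of_lemma102 (hc' : 0 ≤ c') (h102 : Skeleton.Lemma102 c') : Step18_u010 c' :=
  step18_u010_of c' (Skeleton.lemma101_holds hc') h102

/-- `Z22:§18.u011` (reading `𝒴₂ⱼ`) from Lemma 10.2 alone for `c′ ≥ 0`.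
[cite: Zhang2022LandauSiegel, §18 p.100; §10 Lemmas 10.1–10.2] -/
theorem step18_u011b_of_lemma102 (hc' : 0 ≤ c') (h102 : Skeleton.Lemma102 c') :
    Step18_u011b c' :=
  step18_u011b_of c' (Skeleton.lemma101_holds hc') h102

end MainRanges



/-! ### Cone C27 in the kernel: `Skeleton.Ded183 c′` HOLDS; `Z22:§18.u013` and (2.33) from the §10 lemmas -/

section Cone

/-- **`Z22:§18.u013` ⇐ Lemma 10.1 + Lemma 10.2**: the crude bound "`Re{S_j(𝐚₂₃,𝐚₂₃)} < 1100𝔞/log P`"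
follows from the two §10 lemmas (through u008, u009, the four range evaluations — the first range
being seat sz-d56's `Sec18SjNorm.step18_range1_of` — and `Section18SjEdges.step18_u013_of_ranges`).
[cite: Zhang2022LandauSiegel, §18 p.100] -/
theorem step18_u013_of_lemmas (h101 : Skeleton.Lemma101 c') (h102 : Skeleton.Lemma102 c') :
    Step18_u013 c' :=
  step18_u013_of_ranges c' (step18_u008_holds c') (step18_u009_holds c')
    (Sec18SjNorm.step18_range1_of c' h101 h102) (step18_u010_of c' h101 h102)
    (step18_u011b_of c' h101 h102) (step18_u012_holds c')

/-- **The cone-C27 leaf `Skeleton.Ded183 c′` (`Eq183 → Prop71 → Lemma101 → Lemma102 → Bound183`)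
HOLDS, for every `c′`** — "Proof of (2.33)" (Z22 p.100) as a deduction from (18.3), Proposition 7.1
and Lemmas 10.1–10.2, every §18 step in between being a kernel theorem: u008/u009 and u012
outright, the three range evaluations as edges from the two §10 lemmas (`step18_u010_of`,
`step18_u011b_of`, sz-d56's `Sec18SjNorm.step18_range1_of`), u013 by
`Section18SjEdges.step18_u013_of_ranges`, the two-sided size of `S_j` (`sjNorm_of_ranges`) and the
assembly `Sec18Ded183.ded183_of_crude` (seat sz-d56). The one-liner of record agreed on the cell's
STATUS (sz-d56 / sz-L4-lead, RULING 12). [cite: Zhang2022LandauSiegel, §18 p.100, (18.3), (2.33)] -/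
theorem ded183_holds : Skeleton.Ded183 c' := fun h183 h71 h101 h102 =>
  ded183_of_ranges c' (step18_u008_holds c') (step18_u009_holds c')
    (Sec18SjNorm.step18_range1_of c' h101 h102) (step18_u010_of c' h101 h102)
    (step18_u011b_of c' h101 h102) (step18_u012_holds c') h183 h71 h101 h102

/-- `Ded183` — `_holds` alias of `ded183_holds` above under the fact's exact name (appended
2026-08-28, D-0026 bookkeeping: the proof term is the existing theorem of this file; no statement,
definition or attribute is edited; no new named fact; the ledger's debt table listed the fact
unproved). [cite: Zhang2022LandauSiegel, §18 p.100, (18.3), (2.33)] -/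
theorem _root_.Literature.NumberTheory.LFunctions.Zhang2022.Skeleton.Ded183_holds :
    Skeleton.Ded183 c' :=
  _root_.Literature.NumberTheory.LFunctions.Zhang2022.Typed.Section18.ded183_holds (c' := c')

/-- **(2.33) from (18.3), Proposition 7.1 and Lemmas 10.1–10.2**: `Skeleton.Ineq233 c′` follows from
`Skeleton.Eq183 c′`, `Skeleton.Prop71 c′`, `Skeleton.Lemma101 c′`, `Skeleton.Lemma102 c′`
(`Sec18Ded183.ineq233_of_steps` with `step18_u013_of_lemmas` and
`E(𝐚₂₃,𝐚₂₃) = o(𝔓)` from `Sec18Ded183.ecal23Negligible_of_sjNorm` + `sjNorm_of_ranges`). Not the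
typed proof node `Pf233` (hypotheses = the typed §18 displays; of record `Sec18SjNorm.pf233_of_typed`).
[cite: Zhang2022LandauSiegel, §18 p.100, (2.33)] -/
theorem ineq233_of_lemmas (h183 : Skeleton.Eq183 c') (h71 : Skeleton.Prop71 c')
    (h101 : Skeleton.Lemma101 c') (h102 : Skeleton.Lemma102 c') : Skeleton.Ineq233 c' :=
  Sec18Ded183.ineq233_of_steps c' h183 h71 (step18_u013_of_lemmas c' h101 h102)
    (Sec18Ded183.ecal23Negligible_of_sjNorm c'
      (sjNorm_of_ranges c' (step18_u008_holds c') (step18_u009_holds c')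
        (Sec18SjNorm.step18_range1_of c' h101 h102) (step18_u010_of c' h101 h102)
        (step18_u011b_of c' h101 h102) (step18_u012_holds c')))

/-- (2.33) from (18.3), Proposition 7.1 and Lemma 10.2 alone, for `c′ ≥ 0` (Lemma 10.1 DISCHARGED:
`Skeleton.lemma101_holds`). [cite: Zhang2022LandauSiegel, §18 p.100, (2.33)] -/
theorem ineq233_of_lemma102 (hc' : 0 ≤ c') (h183 : Skeleton.Eq183 c') (h71 : Skeleton.Prop71 c')
    (h102 : Skeleton.Lemma102 c') : Skeleton.Ineq233 c' :=
  ineq233_of_lemmas c' h183 h71 (Skeleton.lemma101_holds hc') h102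

end Cone

end Literature.NumberTheory.LFunctions.Zhang2022.Typed.Section18
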